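import Summits.ResolutionOfSingularities.ResolutionOfSingularities.Theorems.EquisingularLiftEquisingularLiftNatResidueHypDefs
import Summits.ResolutionOfSingularities.ResolutionOfSingularities.Theorems.EquisingularLiftEquisingularLiftNatResidueHypDefsND
import Summits.ResolutionOfSingularities.ResolutionOfSingularities.Theorems.EquisingularLiftEquisingularLiftNatNDChartPlays
import Summits.ResolutionOfSingularities.ResolutionOfSingularities.Theorems.EquisingularLiftEquisingularLiftNatNDChartBlowup
import Literature.RingTheory.Flat.RegularFibreFlat
import Literature.AlgebraicGeometry.Resolution.AdicCompletionRegular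
import Mathlib.RingTheory.RegularLocalRing.Polynomial
import Mathlib.RingTheory.Unramified.LocalRing
import Literature.AlgebraicGeometry.Resolution.EtaleNhdOfFlatUnramifiedPoint
import Literature.AlgebraicGeometry.Resolution.VertexBlowupCharts
import Literature.AlgebraicGeometry.Resolution.AffineBlowupUniversal
import Literature.AlgebraicGeometry.Resolution.AffineBlowupCartier
import Literature.AlgebraicGeometry.Resolution.IdealSheafLemmas
import Literature.AlgebraicGeometry.Resolution.BlowupLiftsCongruence
import Literature.AlgebraicGeometry.Resolution.ProjectiveSpaceRegular
import Literature.AlgebraicGeometry.Resolution.AlterationsProofs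
import Literature.RingTheory.MvPolynomial.VariableIdeals

/-!
# `toric-towers` — COMPANION of `NewtonNondegenerateRung.lean`, v11 (g22, SLIM): the `O`-SIDE KERNELS of (O1) and the centres-over-the-point lemma;
# the `k`-side CHART DICTIONARY §12.1–12.8 is now IN THE TREE and imported

crux `EquisingularLiftNatThree`, stmt-ResolutionOfSingularities-20148.  OURS · L1 W4.5(b) · counted 0 · AI-written (weaker than expert review); nothing of
[Hironaka2017] is asserted; no statement of the manuscript; no new definition of the route is touched.  0 sorry; axioms `propext` / `Classical.choice` / `Quot.sound`.

HISTORY (git log of this path in the crux dir = the revision log): v1 54ad50e211ef87b7 (§12.1–12.6) · v2 1a2bb2c8484a610d (+§12.7/12.8) · v3 0e236bf1ba42110a (+§12.9) ·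
v4 391adf33f7303999 (+§12.10) · v5 ba37fd18a38c947f (+`fixesOrigin_symm`, §12.11) · v6 6b765323fa6975dd (SLIM) · v7 9d328515d5b1c593 (+§12.13) · v8 7dd5c78e7ef6cc23 (+§12.14) · v9 6a0a0a3c891fe6b0 (+§12.15).  lead-2 g6 LANDED §12.1–12.8 VERBATIM (bodies) as tree modules, namespace
`Summit.ResolutionOfSingularities.ResolutionOfSingularities.Cruxes.EquisingularLiftNat.Sections.ND`:
* `Theorems/…NatNDChartPullback.lean` (p631995 ✓) = prelude + §12.1 (monomial charts `chartPull` / `toricStrict`, `chartPull_eq_aeval`, …) + §12.2 (E1 ⟺ `Bad`: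
  `toricStrict_vanishes_of_bad`, `bad_iff_toricStrict_vanishes`);
* `Theorems/…NatNDChartEnd.lean` (p632405 ✓) = §12.3 (Khovanskii's chart lemma in Jacobian form: `exists_eval_pderiv_toricStrict_ne_zero`);
* `Theorems/…NatNDChartPlays.lean` = §12.4–12.6 (`not_bad_coordinateFace`, `isConvenientTable_table`, `IsSmoothCone`, `isSmoothCone_of_reach_orthant`, `e1_along_play`,
  `end_of_wonPlay`, `end_of_localNDWon`);
* `Theorems/…NatNDChartBlowup.lean` = §12.7 (Jacobian ⟹ `𝔪`-adic order one: `mul_not_mem_ker_sq_of_eval_pderiv(_map)_ne_zero`, `end_order_one_of_wonPlay`) + §12.8 (one legal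
  star = one `coordBlowupSubst` chart: `starChart`, `coordBlowupSubst_chartPull`, `coordBlowupSubst_toricStrict`, `bad_iff_sum_hminN_lt`).
This slim file (v6 on) DELETES those sections here (no duplicate declarations anywhere) and `open`s the tree namespace; what remains is this seat's not-yet-landed work:

* §12.9 (v3) **(O1) kernel — the linear part of an origin-fixing coordinate change is invertible**: `jac θ` (the matrix of `t_j`-coefficients of the `θ(t_l)`),
  `constantCoeff_map_of_fixesOrigin`, `coeff_single_mul` (Leibniz at the origin in degree one), `coeff_single_map_of_fixesOrigin` (chain rule at the origin: linear part of
  `θ q` = linear part of `q` · `jac θ`), **`jac_symm_mul_jac`** (`jac θ⁻¹ · jac θ = 1` for `FixesOrigin θ`), `isUnit_det_jac`.  Consequence (O1): lifting the COEFFICIENTS of the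
  `θ(t_l)` along `π : O ↠ k` gives `Θ_l ∈ O[t]` whose Jacobian at the section reduces to `jac θ`, a unit — so `(p, Θ₁, …, Θₙ)` is a regular system of parameters of
  `𝒪_{𝔸ⁿ_O, a}` and `Θ : 𝔸ⁿ_O → 𝔸ⁿ_O` is étale at the section (the map along which the standard toric `O`-tower is pulled back); no automorphism of `O[t]` lifting `θ` is
  used (none exists in general: `t ↦ t + p t²`).
  `fixesOrigin_symm` (v5): the change actually lifted is `θ⁻¹` (`f_a = g ∘ Φ_{θ⁻¹}` for `g = θ f_a`).
* §12.10 (v4, crit-3 S-T26 by name) **every E1-legal centre lies over the point**: `exists_pos_of_bad` (a `Bad` face of non-negative rays w.r.t. a CONVENIENT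
  table is positive in every coordinate on some ray — else the axis exponent is a common minimiser), `sum_ray_pos_of_bad` (the created ray is strictly positive),
  `exists_pos_of_bad_chart`, **`chartPull_X_mem_span_of_bad`** (`π^*(t_l) ∈ (u_j : j ∈ J)` for every `l`: the centre `Z_J` of the chart maps to `t = 0`, i.e. to
  the chosen point `a`, at every stage and in every characteristic — so no legal centre ever touches the far part of `ℙⁿ`).
* §12.11 (v5) **the (O1) sentence at the polynomial level**: `jacO`, `monomial_mem_span_X_sq`, `sub_linearPart_mem_span_X_sq` (a polynomial with zero constant
  term is its linear part mod `(t)²`), `X_mem_span_sup_sq` (invertible Jacobian ⇒ `tⱼ ∈ (Θ) + (t)²`, by the adjugate), `exists_coeffLift` (coefficientwise lifts along a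
  surjective `π`), `jacO_map`, `isUnit_det_jacO` (a local hom detects units), **`exists_coeffLift_parameters`**.  With `𝔪 := 𝔪_O·O[t] + (t)` this reads
  `𝔪 = 𝔪_O·O[t] + (Θ) + 𝔪²`, so — by Nakayama in `O[t]_𝔪`, the ONLY step left to the lane owner here — `(p, Θ₁, …, Θₙ)` is a regular system of parameters at the
  section when `O` is a DVR with uniformizer `p`, and `Ψ : t ↦ Θ(t)` is étale on `D(det ∂Θ/∂t) ∋` the section.
* §12.12 (v6) **(O1) NAKAYAMA AT THE SECTION POINT — DONE**: `mem_span_range_X_of_constantCoeff`, `secIdeal n O := 𝔪_O·O[t] ⊔ (t)` (`O` local), `secIdeal_eq_ker`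
  (= kernel of «constant term, then residue»), **`isMaximal_secIdeal`** (the section point is closed, residue field `O/𝔪_O`), `map_sup_span_le_secIdeal`,
  **`maximalIdeal_atSection_eq_map`** (`O` local noetherian; `tⱼ ∈ (Θ) + (t)²` for all `j` ⟹ `maximalIdeal (O[t]_𝔪) = (𝔪_O, Θ)·O[t]_𝔪`, by Mathlib's Nakayama
  `Submodule.le_of_le_smul_of_le_jacobson_bot`), and the package **`exists_parameters_atSection`** (§12.9 + §12.11 + §12.12 in one statement: lifts `Θ` with zero
  constant terms, unit Jacobian, and `𝔪·O[t]_𝔪 = (𝔪_O, Θ)·O[t]_𝔪`).  For `O = W(k)` (`𝔪_O = (p)`): `(p, Θ₁, …, Θₙ)` generate the maximal ideal at the section, i.e.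
  `Ψ : uⱼ ↦ Θⱼ` is UNRAMIFIED at the section with trivial residue extension.  What (O1) still owes is scheme dress only: flatness/étaleness of `Ψ` on
  `D(det ∂Θ/∂t)` (e.g. Mathlib `IsStandardSmoothOfRelativeDimension 0 ⇒ Algebra.Etale` for the presentation `O[u][t]/(Θ(t) − u)`), then (O2)–(O5) = the plumbing
  pieces (B2)–(B5) of the card R8-8.
* §12.13 (v7) **(B1) BY SIGNATURE** (desk R29 (d): «any O-side plumbing piece idea-1 names by signature»): `constantCoeff_aeval_of_constantCoeff_eq_zero`,
  `substHom Θ` (`Ψ^* : uⱼ ↦ Θⱼ` as a ring hom), **`comap_substHom_secIdeal`** (PROVED: the source point of `Ψ` at the section is the section point), and the typed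
  statement **`EtaleAtSection n O : Prop`** — for a regular local `O`: `Θ` with zero constant terms and unit Jacobian ⇒ the local homomorphism
  `Localization.localRingHom (𝔪.comap Ψ^*) 𝔪 Ψ^* rfl` at `𝔪 = secIdeal n O` is `RingHom.Flat` ∧ `RingHom.FormallyUnramified`.  NOT proved here (signature for the
  taker; two routes named in its docstring: Matsumura 23.1 = tree `Literature.RingTheory.Flat.flat_of_isRegularLocalRing_of_maximalIdeal_pow_le` with the field-case
  template `EtaleChartRegularSubscheme.localRingHom_flat_and_formallyUnramified`, or Mathlib `IsStandardSmoothOfRelativeDimension 0 ⇒ Algebra.Etale`); its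
  unramified half and Matsumura's primary hypothesis (exponent 1) ARE `maximalIdeal_atSection_eq_map`.
* §12.14 (v8) **(B1) PROVED: `etaleAtSection : EtaleAtSection n O`** for EVERY regular local `O` and every `n` (so the v7 bullet's «NOT proved» is
  superseded): Matsumura 23.1 in the regular-fibre form (tree `Literature.RingTheory.Flat.flat_of_isRegularLocalRing_of_isRegularLocalRing_fiber`) ported from the
  field-case template with three replacements — (a) `O[t]_𝔭` is regular for every prime `𝔭` (`O` regular local ⇒ regular ring, tree
  `isRegularRing_of_isRegularLocalRing` (Serre); ⇒ `O[t]` regular ring, Mathlib `MvPolynomial.isRegularRing_of_isRegularRing`); (b) the dimension count is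
  trivial because source point = target point (`comap_substHom_secIdeal`); (c) the residue extension is separable because `κ(A) → κ(B)` is SURJECTIVE (`Ψ`
  fixes constant terms) — NO characteristic hypothesis, so it serves `O = W(k)`, `char k = p`.  Axioms of `etaleAtSection`: propext, Classical.choice, Quot.sound.
* §12.15 (v9) **(B1) AT SCHEME LEVEL: `exists_etale_nhd_atSection`** — `∃ U ∋ 𝔪` open in `Spec O[t]` with `U ↪ Spec O[t] --Spec Ψ--> Spec O[t]`
  `AlgebraicGeometry.Etale` (EGA IV₄ 17.6.1 c)⇒a), tree `exists_etale_ι_comp_of_flat_of_formallyUnramified_stalkMap`, through Mathlib `Scheme.arrowStalkMapSpecIso`;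
  `locallyOfFinitePresentation_specMap_algHom_base` = the tree's field-case lemma over any base).  So piece (B1) of R8-8 is DISCHARGED in full; what the
  taker of `nd_rung_local` still does on the `O`-side is (B2)–(B5).
* §12.16 (v10) **(B2) PROVED over ANY base ring `S`: the coordinate blow-up charts of `𝔸ⁿ_S` along `V(xᵢ : i ∈ Λ)`** (the tree's
  `Literature…AffineCoordinateBlowupCharts` is the FIELD case; here the centre is the ideal sheaf `affineBlowup.idealSheaf (xᵢ : i ∈ Λ)`, the ring
  level is the tree's `CoordinateBlowupChart.coordBlowupChartEquiv S Λ i`, the transport the tree's `IsBlowup.exists_chart_of_ringEquiv`): for ANY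
  blowing up `π : W → 𝔸ⁿ_S` of `𝓘_Λ` and `i ∈ Λ` an open immersion **`chartImmS hπ hi : 𝔸ⁿ_S → W`** onto the principal chart `W[⊤, xᵢ]`
  (`isOpenImmersion_chartImmS`, `opensRange_chartImmS`) with **`chartImmS_comp : chartImmS ≫ π = Spec (coordBlowupSubst S Λ i)`**, the `|Λ|`
  charts cover (`iSup_chartS`, `chartCoverS`), **`smooth_compS` / `flat_compS`: `W → Spec S` is SMOOTH, hence FLAT** (the O-flatness clause of
  `ELNatConclusionO` for the ambient members of the O-tower), `isProper_of_isBlowupS`, sections `exists_chartEquivS : Γ(W, W[⊤, xᵢ]) ≅ S[x]`, a model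
  `isBlowup_model` (`affineBlowup.isBlowup`); and (b) BASE CHANGE along any `f : S → T` (`O → k`, `O → Frac O`): `map_comp_coordBlowupSubst`,
  `map_IΛS`, the commuting chart square `specMap_coordBlowupSubst_comp_specMap_map`, `specMap_map_comp_fS` — no flatness of `f` needed (both chart
  rings are polynomial rings over their bases, compatibly).  0 sorry; universe-polymorphic in `S : Type u`.
* §12.17 (v11) **the CENTRES and the MEMBERS of the O-tower in chart coordinates are REGULAR and SMOOTH/FLAT over the base**: `killVars`,
  `ker_killVars : ker = (u_j : j ∈ J)` (via the tree's `VariableIdeals.ker_aeval_ite_eq_span`), **`quotSpanXAlgEquiv : S[u] ⧸ (u_j : j ∈ J) ≃ₐ[S] S[u_i : i ∉ J]`**,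
  `isRegularRing_quot_span_X` (`[IsRegularRing S]`, Mathlib `IsRegularRing.of_ringEquiv` + `MvPolynomial.isRegularRing_of_isRegularRing`), `smooth_quot_span_X :
  Algebra.Smooth S _`, **`isRegular_Spec_quot_span_X : Scheme.IsRegular (Spec (S[u] ⧸ I_J))`** and **`smooth_specMap_quot_span_X` / `flat_specMap_quot_span_X`** (the two
  clauses `Scheme.IsRegular C.subscheme` and `Flat (C.subschemeι ≫ … ≫ Spec O)` of `ELNatConclusionO`, chart-locally, for the coordinate-subspace centres `Z_J`),
  `isRegular_PS`, **`isRegular_of_isBlowupS : IsBlowup π 𝓘_Λ → Scheme.IsRegular W`** (`[IsRegularRing S]`; via the charts of §12.16 and the tree's stalk transport).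
* §12.18 (v11) **the SPECIAL FIBRE in chart coordinates** (`O` local, `π : O → k` surjective onto a field): `ker_eq_maximalIdeal_of_surjective`, `fS_base_asIdeal`,
  `fS_apply_eq_closedPoint_iff : (𝔸ⁿ_O → Spec O) P = closedPoint ↔ 𝔪_O·O[u] ≤ P`, `mem_range_specMap_map_iff`, **`fS_apply_eq_closedPoint_iff_mem_range`: the points over
  the closed point are exactly the image of `Spec (map π) : 𝔸ⁿ_k → 𝔸ⁿ_O`**, `IΛS_le_comap_iff`, **`le_asIdeal_and_eq_closedPoint_iff`: a point of the centre `V(I_J,O)`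
  lies over the closed point iff it is the image of a point of the k-centre `V(I_J,k)`** — the chart-local reading of the clause `C.support ∩ (…)⁻¹{closedPoint O} ⊆ Y'`,
  on which E1 is the k-side `Bad` criterion of the tree's `…NatNDChartPullback`.  0 sorry.
-/

noncomputable section

set_option linter.dupNamespace false

open MvPolynomial

namespace Summit.ResolutionOfSingularities.ResolutionOfSingularities.Cruxes.EquisingularLiftNatThree.Ideas.ToricTowers

open Summit.ResolutionOfSingularities.ResolutionOfSingularities.Cruxes.EquisingularLiftNat.Sections
open Summit.ResolutionOfSingularities.ResolutionOfSingularities.Cruxes.EquisingularLiftNat.Sections.ND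

section ChartDictionary

variable {k : Type} [Field k] {n : ℕ}

/-! ### 12.9 (O1) kernel: the linear part of an origin-fixing coordinate change is invertible (PROVED)

For `θ : k[t] ≃ₐ[k] k[t]` with `FixesOrigin θ` (the coordinate change of `IsoHypNDWon`), the Jacobian matrix at the origin `jac θ = (∂θ(t_l)/∂t_j (0))_{l,j}` is
invertible: `jac θ.symm * jac θ = 1`.  Consequence for (O1): lifting the COEFFICIENTS of the `θ(t_l)` to `O` (`MvPolynomial.map π` is onto) gives `Θ_l ∈ O[t]` whose Jacobian
at the section is a unit of `𝒪_{𝔸ⁿ_O, a}` (its residue is `det (jac θ) ≠ 0`), so `(p, Θ₁, …, Θₙ)` is a regular system of parameters at `a` and `Θ : 𝔸ⁿ_O → 𝔸ⁿ_O` is étale at the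
section — the map along which the standard toric `O`-tower is pulled back (no automorphism of `O[t]` lifting `θ` is needed; none exists in general). -/

/-- The Jacobian matrix at the origin of an algebra endomorphism of `k[t₁,…,tₙ]`: `(jac θ) l j = ` the coefficient of `t_j` in `θ(t_l)`. -/
def jac (θ : MvPolynomial (Fin n) k →ₐ[k] MvPolynomial (Fin n) k) : Matrix (Fin n) (Fin n) k :=
  Matrix.of fun l j => coeff (Finsupp.single j 1) (θ (X l))

/-- An origin-fixing endomorphism preserves constant coefficients. -/
theorem constantCoeff_map_of_fixesOrigin (θ : MvPolynomial (Fin n) k →ₐ[k] MvPolynomial (Fin n) k) (hθ : ∀ l, constantCoeff (θ (X l)) = 0)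
    (q : MvPolynomial (Fin n) k) : constantCoeff (θ q) = constantCoeff q := by
  induction q using MvPolynomial.induction_on with
  | C a => rw [MvPolynomial.algHom_C, MvPolynomial.algebraMap_eq]
  | add p q hp hq => rw [map_add, map_add, map_add, hp, hq]
  | mul_X p l hp => rw [map_mul, map_mul, map_mul, hθ l, constantCoeff_X, mul_zero, mul_zero]

/-- `coeff 0 (r · t_l) = 0`. -/
theorem coeff_zero_mul_X (r : MvPolynomial (Fin n) k) (l : Fin n) : coeff (0 : Fin n →₀ ℕ) (r * X l) = 0 := by
  classical
  rw [coeff_mul_X']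
  simp

/-- `coeff t_j (r · t_l) = δ_{jl} · coeff 0 r`. -/
theorem coeff_single_mul_X (r : MvPolynomial (Fin n) k) (j l : Fin n) :
    coeff (Finsupp.single j 1) (r * X l) = if j = l then coeff (0 : Fin n →₀ ℕ) r else 0 := by
  classical
  rw [coeff_mul_X']
  by_cases h : j = l
  · subst h; rw [if_pos (by simp), if_pos rfl, tsub_self]
  · have hl : l ∉ (Finsupp.single j 1).support := by
      rw [Finsupp.mem_support_iff, Finsupp.single_apply, if_neg h]; exact fun h' => h' rfl
    rw [if_neg hl, if_neg h]

/-- Degree-one coefficients of a product (Leibniz at the origin): `coeff t_j (a r) = a(0) · coeff t_j r + coeff t_j a · r(0)`. -/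
theorem coeff_single_mul (a r : MvPolynomial (Fin n) k) (j : Fin n) :
    coeff (Finsupp.single j 1) (a * r) = coeff 0 a * coeff (Finsupp.single j 1) r + coeff (Finsupp.single j 1) a * coeff 0 r := by
  classical
  induction r using MvPolynomial.induction_on with
  | C c =>
    have hne : (0 : Fin n →₀ ℕ) ≠ Finsupp.single j 1 := by rw [ne_comm, Ne, Finsupp.single_eq_zero]; exact one_ne_zero
    rw [mul_comm, coeff_C_mul, coeff_C, coeff_C, if_neg hne, if_pos rfl]
    ring
  | add p q hp hq => rw [mul_add, coeff_add, hp, hq, coeff_add, coeff_add]; ring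
  | mul_X p l hp =>
    rw [← mul_assoc, coeff_single_mul_X, coeff_single_mul_X, coeff_zero_mul_X, mul_zero, add_zero]
    by_cases h : j = l
    · subst h; rw [if_pos rfl, if_pos rfl, ← constantCoeff_eq]; exact map_mul _ _ _
    · rw [if_neg h, if_neg h, mul_zero]

/-- **Chain rule at the origin, degree one**: the linear part of `θ q` is the linear part of `q` times the Jacobian of `θ` at `0` (for `θ` fixing the origin). -/
theorem coeff_single_map_of_fixesOrigin (θ : MvPolynomial (Fin n) k →ₐ[k] MvPolynomial (Fin n) k) (hθ : ∀ l, constantCoeff (θ (X l)) = 0)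
    (q : MvPolynomial (Fin n) k) (j : Fin n) :
    coeff (Finsupp.single j 1) (θ q) = ∑ l, coeff (Finsupp.single l 1) q * jac θ l j := by
  classical
  induction q using MvPolynomial.induction_on with
  | C a =>
    have hne : ∀ i : Fin n, (0 : Fin n →₀ ℕ) ≠ Finsupp.single i 1 := fun i => by rw [ne_comm, Ne, Finsupp.single_eq_zero]; exact one_ne_zero
    rw [MvPolynomial.algHom_C, MvPolynomial.algebraMap_eq, coeff_C, if_neg (hne j), eq_comm]
    refine Finset.sum_eq_zero fun l _ => ?_
    rw [coeff_C, if_neg (hne l), zero_mul]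
  | add p q hp hq =>
    rw [map_add, coeff_add, hp, hq, ← Finset.sum_add_distrib]
    refine Finset.sum_congr rfl fun l _ => ?_
    rw [coeff_add, add_mul]
  | mul_X p l₀ hp =>
    rw [map_mul, coeff_single_mul]
    have h0 : coeff (0 : Fin n →₀ ℕ) (θ (X l₀)) = 0 := by rw [← constantCoeff_eq]; exact hθ l₀
    have h0p : coeff (0 : Fin n →₀ ℕ) (θ p) = coeff (0 : Fin n →₀ ℕ) p := by
      rw [← constantCoeff_eq]; exact constantCoeff_map_of_fixesOrigin θ hθ p
    rw [h0, mul_zero, add_zero, h0p]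
    simp only [coeff_single_mul_X, ite_mul, zero_mul]
    rw [Finset.sum_ite_eq' Finset.univ l₀, if_pos (Finset.mem_univ _)]
    rfl

/-- **The Jacobian at the origin of an origin-fixing automorphism is invertible**: `jac θ⁻¹ · jac θ = 1`. -/
theorem jac_symm_mul_jac (θ : MvPolynomial (Fin n) k ≃ₐ[k] MvPolynomial (Fin n) k) (hθ : FixesOrigin θ) :
    jac (θ.symm : MvPolynomial (Fin n) k →ₐ[k] MvPolynomial (Fin n) k) * jac (θ : MvPolynomial (Fin n) k →ₐ[k] MvPolynomial (Fin n) k) = 1 := by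
  classical
  have hθ' : ∀ l, constantCoeff ((θ : MvPolynomial (Fin n) k →ₐ[k] MvPolynomial (Fin n) k) (X l)) = 0 := hθ
  ext l₀ j
  have h := coeff_single_map_of_fixesOrigin (θ : MvPolynomial (Fin n) k →ₐ[k] MvPolynomial (Fin n) k) hθ' (θ.symm (X l₀)) j
  have happ : (θ : MvPolynomial (Fin n) k →ₐ[k] MvPolynomial (Fin n) k) (θ.symm (X l₀)) = X l₀ := θ.apply_symm_apply (X l₀)
  have hX : coeff (Finsupp.single j 1) (X l₀ : MvPolynomial (Fin n) k) = if j = l₀ then 1 else 0 := by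
    rw [← one_mul (X l₀ : MvPolynomial (Fin n) k), coeff_single_mul_X, coeff_zero_one]
  rw [happ, hX] at h
  rw [Matrix.mul_apply, Matrix.one_apply]
  have hsum : (∑ l, jac (θ.symm : MvPolynomial (Fin n) k →ₐ[k] MvPolynomial (Fin n) k) l₀ l * jac (θ : MvPolynomial (Fin n) k →ₐ[k] MvPolynomial (Fin n) k) l j)
      = ∑ l, coeff (Finsupp.single l 1) (θ.symm (X l₀)) * jac (θ : MvPolynomial (Fin n) k →ₐ[k] MvPolynomial (Fin n) k) l j :=
    Finset.sum_congr rfl fun l _ => rfl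
  rw [hsum, ← h]
  by_cases hlj : l₀ = j
  · subst hlj; rfl
  · rw [if_neg hlj, if_neg (Ne.symm hlj)]

/-- `FixesOrigin` passes to the inverse automorphism (the coordinate change actually lifted in (O1) is `θ⁻¹`: `f_a = g ∘ Φ_θ⁻¹` for `g = θ f_a`). -/
theorem fixesOrigin_symm (θ : MvPolynomial (Fin n) k ≃ₐ[k] MvPolynomial (Fin n) k) (hθ : FixesOrigin θ) : FixesOrigin θ.symm := by
  intro j
  have h := constantCoeff_map_of_fixesOrigin (θ : MvPolynomial (Fin n) k →ₐ[k] MvPolynomial (Fin n) k) hθ (θ.symm (X j))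
  have happ : (θ : MvPolynomial (Fin n) k →ₐ[k] MvPolynomial (Fin n) k) (θ.symm (X j)) = X j := θ.apply_symm_apply (X j)
  rw [happ, constantCoeff_X] at h
  exact h.symm

theorem isUnit_det_jac (θ : MvPolynomial (Fin n) k ≃ₐ[k] MvPolynomial (Fin n) k) (hθ : FixesOrigin θ) :
    IsUnit (jac (θ : MvPolynomial (Fin n) k →ₐ[k] MvPolynomial (Fin n) k)).det := by
  have h := congrArg Matrix.det (jac_symm_mul_jac θ hθ)
  rw [Matrix.det_mul, Matrix.det_one, mul_comm] at h
  exact IsUnit.of_mul_eq_one _ h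

/-! ### 12.10 (v4, crit-3 S-T26) Every E1-legal centre lies OVER THE POINT: `exists_pos_of_bad`, `chartPull_X_mem_span_of_bad`

In a natural chart `U_B` (rows `B j ∈ ℕⁿ`, §12.5: every chart of every play from `orthantFan n` is of this form) the torus-invariant centre of the star at the
face `J` is `Z_J = V(u_j : j ∈ J)`, and `π^*(t_l) = ∏_j u_j^{B_{jl}}` (`chartPull_eq_aeval`).  For a CONVENIENT table, `Bad` forces every coordinate `l` to be
positive on some ray of the face (else the axis exponent `m·e_l ∈ V` is a common minimiser), hence every `π^*(t_l)` lies in the ideal of `Z_J`: the centre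
maps to the point `t = 0`, i.e. to the chosen singular point `a` — at every stage, in every characteristic (the statement crit-3 asked to have BY NAME:
"every created ray strictly positive ⟹ every legal centre inside `π⁻¹(a)`"). -/

theorem pair_nonneg_of_nonneg {ρ : Ray n} (hρ : ∀ l, 0 ≤ ρ l) (m : Fin n → ℕ) : 0 ≤ pair ρ m :=
  Finset.sum_nonneg fun i _ => mul_nonneg (hρ i) (by exact_mod_cast Nat.zero_le _)

/-- `Bad` face of NON-NEGATIVE rays w.r.t. a CONVENIENT table ⟹ every coordinate is positive on some ray of the face. -/
theorem exists_pos_of_bad {V : Finset (Fin n → ℕ)} (hV : IsConvenientTable V) {τ : Finset (Ray n)} (hτ : ∀ ρ ∈ τ, ∀ l, 0 ≤ ρ l)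
    (hB : Bad V τ) (l : Fin n) : ∃ ρ ∈ τ, 0 < ρ l := by
  by_contra hne
  have hle : ∀ ρ ∈ τ, ρ l ≤ 0 := fun ρ hρ => not_lt.1 fun h => hne ⟨ρ, hρ, h⟩
  obtain ⟨-, hax⟩ := hV
  obtain ⟨v, hv, -, hv0⟩ := hax l
  apply hB
  refine ⟨v, hv, fun ρ hρ m' hm' => ?_⟩
  have hρl : ρ l = 0 := le_antisymm (hle ρ hρ) (hτ ρ hρ l)
  have hpv : pair ρ v = 0 := by
    unfold pair
    refine Finset.sum_eq_zero fun i _ => ?_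
    by_cases hil : i = l
    · rw [hil, hρl, zero_mul]
    · rw [hv0 i hil, Nat.cast_zero, mul_zero]
  rw [hpv]; exact pair_nonneg_of_nonneg (hτ ρ hρ) m'

/-- The created ray `Σ_{ρ ∈ τ} ρ` of a legal star is STRICTLY POSITIVE. -/
theorem sum_ray_pos_of_bad {V : Finset (Fin n → ℕ)} (hV : IsConvenientTable V) {τ : Finset (Ray n)} (hτ : ∀ ρ ∈ τ, ∀ l, 0 ≤ ρ l)
    (hB : Bad V τ) (l : Fin n) : 0 < (∑ ρ ∈ τ, ρ) l := by
  obtain ⟨ρ₀, hρ₀, hpos⟩ := exists_pos_of_bad hV hτ hB l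
  rw [Finset.sum_apply]
  exact lt_of_lt_of_le hpos (Finset.single_le_sum (f := fun ρ => ρ l) (fun ρ hρ => hτ ρ hρ l) hρ₀)

/-- Chart form: in a natural chart `B`, a `Bad` face `J` (CONVENIENT table) has, for every coordinate `l`, a row `j ∈ J` with `B j l ≥ 1`. -/
theorem exists_pos_of_bad_chart {V : Finset (Fin n → ℕ)} (hV : IsConvenientTable V) (B : Fin n → Fin n → ℕ) (J : Finset (Fin n))
    (hB : Bad V (J.image fun j => rayOf (B j))) (l : Fin n) : ∃ j ∈ J, 0 < B j l := by
  have hτ : ∀ ρ ∈ J.image (fun j => rayOf (B j)), ∀ l, 0 ≤ ρ l := by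
    intro ρ hρ l'
    obtain ⟨j, -, rfl⟩ := Finset.mem_image.1 hρ
    show (0 : ℤ) ≤ ((B j l' : ℕ) : ℤ)
    exact_mod_cast Nat.zero_le _
  obtain ⟨ρ, hρ, hpos⟩ := exists_pos_of_bad hV hτ hB l
  obtain ⟨j, hj, rfl⟩ := Finset.mem_image.1 hρ
  have hpos' : (0 : ℤ) < ((B j l : ℕ) : ℤ) := hpos
  exact ⟨j, hj, by exact_mod_cast hpos'⟩

/-- **Every E1-legal centre lies over the point.**  In the natural chart `B`, for a `Bad` face `J` of a CONVENIENT table, every base coordinate pulls back into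
the ideal of the centre `Z_J = V(u_j : j ∈ J)`: `π^*(t_l) = ∏_i u_i^{B_{il}} ∈ (u_j : j ∈ J)` for all `l`. -/
theorem chartPull_X_mem_span_of_bad {V : Finset (Fin n → ℕ)} (hV : IsConvenientTable V) (B : Fin n → Fin n → ℕ) (J : Finset (Fin n))
    (hB : Bad V (J.image fun j => rayOf (B j))) (l : Fin n) :
    chartPull B (X l : MvPolynomial (Fin n) k) ∈ Ideal.span ((fun j => (X j : MvPolynomial (Fin n) k)) '' (↑J : Set (Fin n))) := by
  classical
  obtain ⟨j₀, hj₀, hpos⟩ := exists_pos_of_bad_chart hV B J hB l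
  rw [chartPull_eq_aeval, aeval_X, ← Finset.mul_prod_erase Finset.univ (fun i => (X i : MvPolynomial (Fin n) k) ^ B i l) (Finset.mem_univ j₀)]
  have hsplit : (X j₀ : MvPolynomial (Fin n) k) ^ B j₀ l = X j₀ * X j₀ ^ (B j₀ l - 1) := by
    rw [← pow_succ', Nat.sub_add_cancel hpos]
  rw [hsplit, mul_assoc]
  exact Ideal.mul_mem_right _ _ (Ideal.subset_span ⟨j₀, Finset.mem_coe.2 hj₀, rfl⟩)

/-! ### 12.11 (v5) The (O1) SENTENCE at the polynomial level: coefficient lifts `Θ` of `θ` with `t_j ∈ (Θ) + (t)²` over `O`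

For `π : O ↠ k` with `IsLocalHom π` (e.g. the residue map of a local ring `O`; `O = W(k)`), an origin-fixing automorphism `θ` of `k[t]` has COEFFICIENT LIFTS
`Θ_l ∈ O[t]` (`map π Θ_l = θ(t_l)`, zero constant terms), and for ANY such lifts every `t_j` lies in `(Θ₁, …, Θₙ) + (t₁, …, tₙ)²` — because the Jacobian of `Θ` at
`t = 0` reduces under `π` to `jac θ`, a unit (§12.9), hence is a unit of `O`.  Consequently (Nakayama in `𝒪_{𝔸ⁿ_O, a}`, `a` = the section `t = 0` over the closed point):
`𝔪_a = (𝔪_O, Θ₁, …, Θₙ)`, so for a DVR `O` with uniformizer `p` the family `(p, Θ₁, …, Θₙ)` is a regular system of parameters at `a` — the (O1) sentence of R8-2. -/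

section LiftO

variable {O : Type} [CommRing O]

/-- The Jacobian at the origin of a family `Θ : Fin n → O[t]`: `(jacO Θ) l j = ∂Θ_l/∂t_j (0)`. -/
def jacO (Θ : Fin n → MvPolynomial (Fin n) O) : Matrix (Fin n) (Fin n) O := Matrix.of fun l j => coeff (Finsupp.single j 1) (Θ l)

/-- A monomial of degree `≥ 2` (exponent `≠ 0` and not a single variable) lies in `(t₁, …, tₙ)²`. -/
theorem monomial_mem_span_X_sq {d : Fin n →₀ ℕ} (hd0 : d ≠ 0) (hd1 : ∀ j, d ≠ Finsupp.single j 1) (c : O) :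
    (monomial d c : MvPolynomial (Fin n) O) ∈ (Ideal.span (Set.range (X : Fin n → MvPolynomial (Fin n) O))) ^ 2 := by
  classical
  obtain ⟨i, hi⟩ : ∃ i, d i ≠ 0 := by
    by_contra h
    exact hd0 (Finsupp.ext fun i => by simpa using (not_exists.1 h) i)
  have hi1 : Finsupp.single i 1 ≤ d := Finsupp.single_le_iff.2 (Nat.one_le_iff_ne_zero.2 hi)
  -- a second variable (possibly `i` again) divides `d - e_i`
  obtain ⟨i', hi'⟩ : ∃ i', (d - Finsupp.single i 1 : Fin n →₀ ℕ) i' ≠ 0 := by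
    by_contra h
    apply hd1 i
    have hz : (d - Finsupp.single i 1 : Fin n →₀ ℕ) = 0 := Finsupp.ext fun l => by simpa using (not_exists.1 h) l
    have := tsub_add_cancel_of_le hi1
    rw [hz, zero_add] at this
    exact this.symm
  have hi'1 : Finsupp.single i' 1 ≤ d - Finsupp.single i 1 := Finsupp.single_le_iff.2 (Nat.one_le_iff_ne_zero.2 hi')
  have hexp : Finsupp.single i 1 + (Finsupp.single i' 1 + (d - Finsupp.single i 1 - Finsupp.single i' 1)) = d := by
    rw [add_tsub_cancel_of_le hi'1, add_tsub_cancel_of_le hi1]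
  have hsplit : (monomial d c : MvPolynomial (Fin n) O) = X i * (X i' * monomial (d - Finsupp.single i 1 - Finsupp.single i' 1) c) := by
    rw [X, X, monomial_mul, monomial_mul, one_mul, one_mul, hexp]
  rw [hsplit, pow_two]
  exact Ideal.mul_mem_mul (Ideal.subset_span ⟨i, rfl⟩) (Ideal.mul_mem_right _ _ (Ideal.subset_span ⟨i', rfl⟩))

/-- `q − (linear part of q) ∈ (t)²` for `q` with zero constant term. -/
theorem sub_linearPart_mem_span_X_sq (q : MvPolynomial (Fin n) O) (h0 : constantCoeff q = 0) :
    q - ∑ j, C (coeff (Finsupp.single j 1) q) * X j ∈ (Ideal.span (Set.range (X : Fin n → MvPolynomial (Fin n) O))) ^ 2 := by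
  classical
  set r := q - ∑ j, C (coeff (Finsupp.single j 1) q) * X j with hr
  have hlin : ∀ (m : Fin n →₀ ℕ), coeff m (∑ j, C (coeff (Finsupp.single j 1) q) * (X j : MvPolynomial (Fin n) O))
      = ∑ j, if m = Finsupp.single j 1 then coeff (Finsupp.single j 1) q else 0 := by
    intro m
    rw [coeff_sum]
    refine Finset.sum_congr rfl fun j _ => ?_
    rw [coeff_C_mul, X, coeff_monomial, mul_ite, mul_one, mul_zero]
    by_cases h : m = Finsupp.single j 1
    · rw [if_pos h, if_pos h.symm]
    · rw [if_neg h, if_neg (Ne.symm h)]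
  have hne0 : ∀ j : Fin n, (0 : Fin n →₀ ℕ) ≠ Finsupp.single j 1 := fun j => by
    rw [ne_comm, Ne, Finsupp.single_eq_zero]; exact one_ne_zero
  have hc0 : coeff (0 : Fin n →₀ ℕ) r = 0 := by
    have h := hlin 0
    simp only [if_neg (hne0 _), Finset.sum_const_zero] at h
    rw [hr, coeff_sub, h, sub_zero, ← constantCoeff_eq, h0]
  have hc1 : ∀ j, coeff (Finsupp.single j 1) r = 0 := by
    intro j
    rw [hr, coeff_sub, hlin, sub_eq_zero]
    rw [Finset.sum_eq_single j]
    · rw [if_pos rfl]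
    · intro j' _ hj'
      rw [if_neg]
      intro h
      exact hj' ((Finsupp.single_left_injective one_ne_zero) h).symm
    · intro h; exact absurd (Finset.mem_univ j) h
  rw [r.as_sum]
  refine Submodule.sum_mem _ fun d hd => ?_
  refine monomial_mem_span_X_sq (fun h => ?_) (fun j h => ?_) _
  · rw [h] at hd; exact (mem_support_iff.1 hd) hc0
  · rw [h] at hd; exact (mem_support_iff.1 hd) (hc1 j)

/-- **`t_j ∈ (Θ) + (t)²`** for any family `Θ` with zero constant terms and INVERTIBLE Jacobian at the origin. -/
theorem X_mem_span_sup_sq (Θ : Fin n → MvPolynomial (Fin n) O) (h0 : ∀ l, constantCoeff (Θ l) = 0) (hJ : IsUnit (jacO Θ).det) (j : Fin n) :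
    (X j : MvPolynomial (Fin n) O) ∈ Ideal.span (Set.range Θ) ⊔ (Ideal.span (Set.range (X : Fin n → MvPolynomial (Fin n) O))) ^ 2 := by
  classical
  set I := Ideal.span (Set.range Θ) ⊔ (Ideal.span (Set.range (X : Fin n → MvPolynomial (Fin n) O))) ^ 2 with hI
  -- the linear parts `L_l = Σ_i J_{li} t_i` lie in `I`
  have hL : ∀ l, (∑ i, C (jacO Θ l i) * (X i : MvPolynomial (Fin n) O)) ∈ I := by
    intro l
    have h1 : Θ l ∈ I := Ideal.mem_sup_left (Ideal.subset_span ⟨l, rfl⟩)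
    have h2 : Θ l - ∑ j, C (coeff (Finsupp.single j 1) (Θ l)) * X j ∈ I := Ideal.mem_sup_right (sub_linearPart_mem_span_X_sq (Θ l) (h0 l))
    have h3 := Submodule.sub_mem _ h1 h2
    rwa [sub_sub_cancel] at h3
  -- invert the Jacobian
  set J' := (jacO Θ)⁻¹ with hJ'
  have hinv : J' * jacO Θ = 1 := Matrix.nonsing_inv_mul _ hJ
  have hcomb : (∑ l, C (J' j l) * ∑ i, C (jacO Θ l i) * (X i : MvPolynomial (Fin n) O)) = X j := by
    have step : (∑ l, C (J' j l) * ∑ i, C (jacO Θ l i) * (X i : MvPolynomial (Fin n) O))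
        = ∑ i, C ((J' * jacO Θ) j i) * (X i : MvPolynomial (Fin n) O) := by
      simp only [Finset.mul_sum, ← mul_assoc, ← C_mul]
      rw [Finset.sum_comm]
      refine Finset.sum_congr rfl fun i _ => ?_
      rw [← Finset.sum_mul, ← map_sum, Matrix.mul_apply]
    rw [step, hinv]
    simp only [Matrix.one_apply]
    rw [Finset.sum_eq_single j]
    · rw [if_pos rfl, C_1, one_mul]
    · intro i _ hij; rw [if_neg (Ne.symm hij), C_0, zero_mul]
    · intro h; exact absurd (Finset.mem_univ j) h
  rw [← hcomb]
  exact Submodule.sum_mem _ fun l _ => Ideal.mul_mem_left _ _ (hL l)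

/-- Coefficient lifts exist: `θ(t_l)` lifts along a surjective `π : O → k` to `Θ_l ∈ O[t]` with zero constant term. -/
theorem exists_coeffLift (π : O →+* k) (hπ : Function.Surjective π) (θ : MvPolynomial (Fin n) k →ₐ[k] MvPolynomial (Fin n) k)
    (hθ : ∀ l, constantCoeff (θ (X l)) = 0) :
    ∃ Θ : Fin n → MvPolynomial (Fin n) O, (∀ l, MvPolynomial.map π (Θ l) = θ (X l)) ∧ ∀ l, constantCoeff (Θ l) = 0 := by
  have h := fun l => MvPolynomial.map_surjective π hπ (θ (X l))
  choose Θ' hΘ' using h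
  refine ⟨fun l => Θ' l - C (constantCoeff (Θ' l)), fun l => ?_, fun l => ?_⟩
  · rw [map_sub, map_C, hΘ', ← constantCoeff_map π (Θ' l), hΘ', hθ l, C_0, sub_zero]
  · rw [map_sub, constantCoeff_C, sub_self]

/-- The Jacobian of a coefficient lift reduces to `jac θ`; under a LOCAL `π` it is therefore invertible as soon as `jac θ` is. -/
theorem jacO_map (π : O →+* k) (θ : MvPolynomial (Fin n) k →ₐ[k] MvPolynomial (Fin n) k) (Θ : Fin n → MvPolynomial (Fin n) O)
    (hΘ : ∀ l, MvPolynomial.map π (Θ l) = θ (X l)) : (jacO Θ).map π = jac θ := by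
  ext l j
  simp only [Matrix.map_apply, jacO, jac, Matrix.of_apply]
  rw [← coeff_map, hΘ]

theorem isUnit_det_jacO (π : O →+* k) [IsLocalHom π] (θ : MvPolynomial (Fin n) k ≃ₐ[k] MvPolynomial (Fin n) k) (hθ : FixesOrigin θ)
    (Θ : Fin n → MvPolynomial (Fin n) O) (hΘ : ∀ l, MvPolynomial.map π (Θ l) = θ (X l)) : IsUnit (jacO Θ).det := by
  have h := isUnit_det_jac θ hθ
  rw [← jacO_map π (θ : MvPolynomial (Fin n) k →ₐ[k] MvPolynomial (Fin n) k) Θ hΘ, ← RingHom.mapMatrix_apply, ← RingHom.map_det] at h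
  exact (isUnit_map_iff π _).1 h

/-- **(O1), polynomial level.**  For a surjective LOCAL `π : O → k` and an origin-fixing automorphism `θ` of `k[t]`: coefficient lifts `Θ` exist, and for them every `t_j`
lies in `(Θ₁, …, Θₙ) + (t)²` in `O[t]`. -/
theorem exists_coeffLift_parameters (π : O →+* k) (hπ : Function.Surjective π) [IsLocalHom π]
    (θ : MvPolynomial (Fin n) k ≃ₐ[k] MvPolynomial (Fin n) k) (hθ : FixesOrigin θ) :
    ∃ Θ : Fin n → MvPolynomial (Fin n) O, (∀ l, MvPolynomial.map π (Θ l) = θ (X l)) ∧ (∀ l, constantCoeff (Θ l) = 0) ∧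
      ∀ j, (X j : MvPolynomial (Fin n) O) ∈ Ideal.span (Set.range Θ) ⊔ (Ideal.span (Set.range (X : Fin n → MvPolynomial (Fin n) O))) ^ 2 := by
  obtain ⟨Θ, hΘ, h0⟩ := exists_coeffLift π hπ (θ : MvPolynomial (Fin n) k →ₐ[k] MvPolynomial (Fin n) k) hθ
  exact ⟨Θ, hΘ, h0, X_mem_span_sup_sq Θ h0 (isUnit_det_jacO π θ hθ Θ hΘ)⟩

end LiftO

/-! ### 12.12 (v6) (O1) at the SECTION POINT: `𝔪 := 𝔪_O·O[t] + (t)` is a maximal ideal of `O[t]` and, localised at it, is generated by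
`𝔪_O` and `Θ` — NAKAYAMA DONE.  With `O` a DVR (`𝔪_O = (p)`) this says: `(p, Θ₁, …, Θₙ)` generate the maximal ideal of `O[t]_𝔪`, i.e.
the `O[u]`-algebra map `Ψ : uⱼ ↦ Θⱼ` is UNRAMIFIED at the section with trivial residue extension; the (O1) debt is now only its scheme dress
(flatness/étaleness on `D(det ∂Θ/∂t)`, e.g. Mathlib's `IsStandardSmoothOfRelativeDimension 0 ⇒ Etale` for the presentation `O[u][t]/(Θ(t) − u)`). -/

section Nakayama

variable {O : Type} [CommRing O]

/-- A polynomial with zero constant term lies in the ideal `(t₁, …, tₙ)`. -/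
theorem mem_span_range_X_of_constantCoeff {q : MvPolynomial (Fin n) O} (h : constantCoeff q = 0) :
    q ∈ Ideal.span (Set.range (X : Fin n → MvPolynomial (Fin n) O)) := by
  rw [← Set.image_univ, MvPolynomial.mem_ideal_span_X_image]
  intro m hm
  have hm0 : m ≠ 0 := by
    rintro rfl
    rw [MvPolynomial.mem_support_iff] at hm
    exact hm (by rw [← h]; exact (congrFun MvPolynomial.constantCoeff_eq q).symm)
  obtain ⟨i, hi⟩ := DFunLike.ne_iff.mp hm0
  exact ⟨i, Set.mem_univ _, by simpa using hi⟩

/-- The ideal of the SECTION POINT `t = 0` over the closed point of a local `O`: `𝔪_O·O[t] + (t₁, …, tₙ)`. -/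
def secIdeal (n : ℕ) (O : Type) [CommRing O] [IsLocalRing O] : Ideal (MvPolynomial (Fin n) O) :=
  Ideal.map (C : O →+* MvPolynomial (Fin n) O) (IsLocalRing.maximalIdeal O) ⊔
    Ideal.span (Set.range (X : Fin n → MvPolynomial (Fin n) O))

/-- `secIdeal` is the kernel of «constant term, then residue»: `O[t] → O → O/𝔪_O`. -/
theorem secIdeal_eq_ker [IsLocalRing O] :
    secIdeal n O = RingHom.ker ((IsLocalRing.residue O).comp (constantCoeff : MvPolynomial (Fin n) O →+* O)) := by
  apply le_antisymm
  · refine sup_le (Ideal.map_le_iff_le_comap.mpr fun a ha => ?_) (Ideal.span_le.mpr ?_)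
    · rw [Ideal.mem_comap, RingHom.mem_ker, RingHom.comp_apply, constantCoeff_C]
      exact (IsLocalRing.residue_eq_zero_iff _).mpr ha
    · rintro _ ⟨j, rfl⟩
      rw [SetLike.mem_coe, RingHom.mem_ker, RingHom.comp_apply, constantCoeff_X, map_zero]
  · intro q hq
    rw [RingHom.mem_ker, RingHom.comp_apply, IsLocalRing.residue_eq_zero_iff] at hq
    have hsplit : q = C (constantCoeff q) + (q - C (constantCoeff q)) := by ring
    rw [hsplit]
    exact Ideal.add_mem _ (Ideal.mem_sup_left (Ideal.mem_map_of_mem _ hq))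
      (Ideal.mem_sup_right (mem_span_range_X_of_constantCoeff (by rw [map_sub, constantCoeff_C, sub_self])))

/-- The section point is a CLOSED point: `secIdeal` is maximal (residue field `O/𝔪_O`). -/
theorem isMaximal_secIdeal [IsLocalRing O] : (secIdeal n O).IsMaximal := by
  rw [secIdeal_eq_ker]
  refine RingHom.ker_isMaximal_of_surjective _ fun x => ?_
  obtain ⟨a, rfl⟩ := Ideal.Quotient.mk_surjective x
  exact ⟨C a, by rw [RingHom.comp_apply, constantCoeff_C]; rfl⟩

/-- Every `Θₗ` with zero constant term, and `𝔪_O`, lie in `secIdeal`. -/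
theorem map_sup_span_le_secIdeal [IsLocalRing O] (Θ : Fin n → MvPolynomial (Fin n) O) (h0 : ∀ l, constantCoeff (Θ l) = 0) :
    Ideal.map (C : O →+* MvPolynomial (Fin n) O) (IsLocalRing.maximalIdeal O) ⊔ Ideal.span (Set.range Θ) ≤ secIdeal n O :=
  sup_le le_sup_left (Ideal.span_le.mpr (by
    rintro _ ⟨l, rfl⟩
    exact Ideal.mem_sup_right (mem_span_range_X_of_constantCoeff (h0 l))))

/-- **(O1) NAKAYAMA DONE.**  If every `tⱼ ∈ (Θ) + (t)²` (§12.11 `exists_coeffLift_parameters`) and the `Θₗ` have zero constant term, then in the local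
ring `O[t]_𝔪` of the section point the maximal ideal is generated by `𝔪_O` and `Θ₁, …, Θₙ`.  (`P` is `secIdeal n O` — passed with its `IsPrime`
instance so that `Localization.AtPrime P` typechecks; `isMaximal_secIdeal` supplies it.) -/
theorem maximalIdeal_atSection_eq_map [IsLocalRing O] [IsNoetherianRing O] (Θ : Fin n → MvPolynomial (Fin n) O)
    (h0 : ∀ l, constantCoeff (Θ l) = 0)
    (hX : ∀ j, (X j : MvPolynomial (Fin n) O) ∈ Ideal.span (Set.range Θ) ⊔ (Ideal.span (Set.range (X : Fin n → MvPolynomial (Fin n) O))) ^ 2)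
    (P : Ideal (MvPolynomial (Fin n) O)) [P.IsPrime] (hP : P = secIdeal n O) :
    IsLocalRing.maximalIdeal (Localization.AtPrime P) =
      Ideal.map (algebraMap (MvPolynomial (Fin n) O) (Localization.AtPrime P))
        (Ideal.map (C : O →+* MvPolynomial (Fin n) O) (IsLocalRing.maximalIdeal O) ⊔ Ideal.span (Set.range Θ)) := by
  set A := Localization.AtPrime P
  set N₀ := Ideal.map (C : O →+* MvPolynomial (Fin n) O) (IsLocalRing.maximalIdeal O) ⊔ Ideal.span (Set.range Θ) with hN₀
  have hM : IsLocalRing.maximalIdeal A = P.map (algebraMap _ A) := (Localization.AtPrime.map_eq_maximalIdeal).symm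
  -- `N ≤ 𝔪`
  have hN₀P : N₀ ≤ P := by rw [hP]; exact map_sup_span_le_secIdeal Θ h0
  have hNM : N₀.map (algebraMap _ A) ≤ IsLocalRing.maximalIdeal A := by rw [hM]; exact Ideal.map_mono hN₀P
  -- `𝔪 ≤ N + 𝔪²` before localising
  have hPle : P ≤ N₀ ⊔ P ^ 2 := by
    have hsec : secIdeal n O ≤ N₀ ⊔ (secIdeal n O) ^ 2 := by
      refine sup_le (le_sup_of_le_left le_sup_left) (Ideal.span_le.mpr ?_)
      rintro _ ⟨j, rfl⟩
      have hle : Ideal.span (Set.range Θ) ⊔ Ideal.span (Set.range (X : Fin n → MvPolynomial (Fin n) O)) ^ 2 ≤ N₀ ⊔ (secIdeal n O) ^ 2 := by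
        refine sup_le_sup le_sup_right ?_
        rw [pow_two, pow_two]
        exact Ideal.mul_mono le_sup_right le_sup_right
      exact hle (hX j)
    rw [hP]; exact hsec
  -- localise and apply Nakayama
  have hMle : IsLocalRing.maximalIdeal A ≤ N₀.map (algebraMap _ A) ⊔ IsLocalRing.maximalIdeal A • IsLocalRing.maximalIdeal A := by
    rw [Ideal.smul_eq_mul, ← pow_two, hM, ← Ideal.map_pow, ← Ideal.map_sup]
    exact Ideal.map_mono hPle
  haveI : IsNoetherianRing A := IsLocalization.isNoetherianRing P.primeCompl A inferInstance
  have hfg : (IsLocalRing.maximalIdeal A).FG := IsNoetherian.noetherian _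
  exact le_antisymm (Submodule.le_of_le_smul_of_le_jacobson_bot hfg (IsLocalRing.maximalIdeal_le_jacobson _) hMle) hNM


/-- **(O1) PACKAGED** (§12.9 + §12.11 + §12.12): along a surjective local `π : O → k` (`O` local noetherian — e.g. `W(k) → k`), every origin-fixing
`θ : k[t] ≃ₐ[k] k[t]` has coefficient lifts `Θ₁, …, Θₙ ∈ O[t]` with zero constant terms, Jacobian at the section a UNIT, and
`𝔪·O[t]_𝔪 = (𝔪_O, Θ₁, …, Θₙ)·O[t]_𝔪` at the section point `𝔪 = secIdeal n O`.  Apply it to `θ⁻¹` (`fixesOrigin_symm`). -/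
theorem exists_parameters_atSection [IsLocalRing O] [IsNoetherianRing O] (π : O →+* k) (hπ : Function.Surjective π) [IsLocalHom π]
    (θ : MvPolynomial (Fin n) k ≃ₐ[k] MvPolynomial (Fin n) k) (hθ : FixesOrigin θ)
    (P : Ideal (MvPolynomial (Fin n) O)) [P.IsPrime] (hP : P = secIdeal n O) :
    ∃ Θ : Fin n → MvPolynomial (Fin n) O,
      (∀ l, MvPolynomial.map π (Θ l) = θ (X l)) ∧ (∀ l, constantCoeff (Θ l) = 0) ∧ IsUnit (jacO Θ).det ∧
      IsLocalRing.maximalIdeal (Localization.AtPrime P) =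
        Ideal.map (algebraMap (MvPolynomial (Fin n) O) (Localization.AtPrime P))
          (Ideal.map (C : O →+* MvPolynomial (Fin n) O) (IsLocalRing.maximalIdeal O) ⊔ Ideal.span (Set.range Θ)) := by
  obtain ⟨Θ, h1, h2, h3⟩ := exists_coeffLift_parameters π hπ θ hθ
  exact ⟨Θ, h1, h2, isUnit_det_jacO π θ hθ Θ h1, maximalIdeal_atSection_eq_map Θ h2 h3 P hP⟩

end Nakayama

/-! ### 12.13 (v7) (B1) BY SIGNATURE — «`Ψ : uⱼ ↦ Θⱼ(t)` is flat and unramified at the section»: the source point, and the typed statement -/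

section EtaleSignature

variable {O : Type} [CommRing O]

/-- Substituting polynomials WITHOUT constant term does not change the constant term. -/
theorem constantCoeff_aeval_of_constantCoeff_eq_zero (Θ : Fin n → MvPolynomial (Fin n) O) (h0 : ∀ l, constantCoeff (Θ l) = 0)
    (q : MvPolynomial (Fin n) O) : constantCoeff (aeval Θ q) = constantCoeff q := by
  induction q using MvPolynomial.induction_on with
  | C a => rw [aeval_C, algebraMap_eq]
  | add p q hp hq => rw [map_add, map_add, map_add, hp, hq]
  | mul_X p l hp => rw [map_mul, aeval_X, map_mul, map_mul, hp, h0 l, constantCoeff_X]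

/-- `Ψ^* : O[u] → O[t]`, `uⱼ ↦ Θⱼ(t)` — the substitution ring homomorphism (`MvPolynomial.aeval Θ` as a `RingHom`). -/
def substHom (Θ : Fin n → MvPolynomial (Fin n) O) : MvPolynomial (Fin n) O →+* MvPolynomial (Fin n) O :=
  (aeval Θ : MvPolynomial (Fin n) O →ₐ[O] MvPolynomial (Fin n) O).toRingHom

theorem substHom_apply (Θ : Fin n → MvPolynomial (Fin n) O) (q : MvPolynomial (Fin n) O) : substHom Θ q = aeval Θ q := rfl

/-- The SOURCE point of `Ψ` at the section is again the section point: `Ψ⁻¹(𝔪) = 𝔪` for `𝔪 = secIdeal n O`. -/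
theorem comap_substHom_secIdeal [IsLocalRing O] (Θ : Fin n → MvPolynomial (Fin n) O) (h0 : ∀ l, constantCoeff (Θ l) = 0) :
    (secIdeal n O).comap (substHom Θ) = secIdeal n O := by
  ext q
  rw [Ideal.mem_comap, secIdeal_eq_ker, RingHom.mem_ker, RingHom.mem_ker, RingHom.comp_apply, RingHom.comp_apply, substHom_apply,
    constantCoeff_aeval_of_constantCoeff_eq_zero Θ h0]

/-- **(B1) AS A TYPED STATEMENT** (a `Prop`, OURS) — **PROVED below: `etaleAtSection` (§12.14)**.  For a regular local base `O` and
`Θ₁, …, Θₙ ∈ O[t]` with zero constant terms and unit Jacobian at the section: the local homomorphism `Ψ_𝔪 : O[u]_{Ψ⁻¹𝔪} → O[t]_𝔪`,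
`uⱼ ↦ Θⱼ`, at the section point `𝔪 = secIdeal n O` (where `Ψ⁻¹𝔪 = 𝔪`, `comap_substHom_secIdeal`) is FLAT and FORMALLY UNRAMIFIED.
The input `maximalIdeal_atSection_eq_map` (`𝔪·O[t]_𝔪 = (𝔪_O, Θ)·O[t]_𝔪` = the image of the source's maximal ideal) gives unramifiedness
with trivial residue extension and Matsumura 23.1's regular (indeed trivial) fibre; flatness is then the tree's
`Literature.RingTheory.Flat.flat_of_isRegularLocalRing_of_isRegularLocalRing_fiber` (template over a field:
`Literature.AlgebraicGeometry.Resolution.localRingHom_flat_and_formallyUnramified`).  [OURS] -/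
def EtaleAtSection (n : ℕ) (O : Type) [CommRing O] [IsRegularLocalRing O] : Prop :=
  ∀ (Θ : Fin n → MvPolynomial (Fin n) O), (∀ l, constantCoeff (Θ l) = 0) → IsUnit (jacO Θ).det →
    ∀ (P : Ideal (MvPolynomial (Fin n) O)) [P.IsPrime], P = secIdeal n O →
      (Localization.localRingHom (P.comap (substHom Θ)) P (substHom Θ) rfl).Flat ∧
      (Localization.localRingHom (P.comap (substHom Θ)) P (substHom Θ) rfl).FormallyUnramified

end EtaleSignature

/-! ### 12.14 (B1) PROVED: `Ψ : uⱼ ↦ Θⱼ` is flat and unramified at the section (`O` regular local, any `n`)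

Matsumura 23.1 in the regular-fibre form (tree `Literature.RingTheory.Flat.flat_of_isRegularLocalRing_of_isRegularLocalRing_fiber`), ported
from the field-case template `Literature.AlgebraicGeometry.Resolution.localRingHom_flat_and_formallyUnramified` with three replacements:
(a) regularity of `O[t]_𝔭` for EVERY prime `𝔭` — `O` regular local ⇒ `O` a regular ring (Serre, tree `isRegularRing_of_isRegularLocalRing`) ⇒
`O[t]` a regular ring (Mathlib `MvPolynomial.isRegularRing_of_isRegularRing`) ⇒ its localizations are regular local (Mathlib instance);
(b) the dimension count is trivial because SOURCE POINT = TARGET POINT (`comap_substHom_secIdeal`: `Ψ⁻¹𝔪 = 𝔪`, so `dim A = ht 𝔪 = dim B`);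
(c) separability of the residue extension holds because `κ(A) → κ(B)` is SURJECTIVE (both are `O[t]/𝔪 = O/𝔪_O` and `Ψ` fixes constant terms) —
no characteristic hypothesis.  The equality `𝔪_A B = 𝔪_B` is `maximalIdeal_atSection_eq_map` (§12.12). -/
section EtaleProof

variable {O : Type} [CommRing O]

theorem C_mem_secIdeal [IsLocalRing O] {a : O} (ha : a ∈ IsLocalRing.maximalIdeal O) : (C a : MvPolynomial (Fin n) O) ∈ secIdeal n O :=
  Ideal.mem_sup_left (Ideal.mem_map_of_mem _ ha)

theorem mem_secIdeal_of_constantCoeff [IsLocalRing O] {q : MvPolynomial (Fin n) O} (h : constantCoeff q = 0) : q ∈ secIdeal n O :=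
  Ideal.mem_sup_right (mem_span_range_X_of_constantCoeff h)

/-- **(B1) PROVED.**  For a regular local ring `O` and `Θ₁, …, Θₙ ∈ O[t]` with zero constant terms and invertible Jacobian at the section, the
local homomorphism of `Ψ : uⱼ ↦ Θⱼ` at the section point `𝔪 = 𝔪_O·O[t] + (t)` (whose source point is `𝔪` again) is FLAT and FORMALLY
UNRAMIFIED.  [OURS · L1 W4.5b; Matsumura1987 Thm. 23.1 via the tree; no characteristic hypothesis] -/
theorem etaleAtSection (n : ℕ) (O : Type) [CommRing O] [IsRegularLocalRing O] : EtaleAtSection n O := by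
  classical
  intro Θ h0 hdet P _ hP
  haveI : IsRegularRing O := Literature.AlgebraicGeometry.Resolution.isRegularRing_of_isRegularLocalRing O
  haveI : P.IsMaximal := hP ▸ isMaximal_secIdeal
  set Ψ : MvPolynomial (Fin n) O →+* MvPolynomial (Fin n) O := substHom Θ with hΨdef
  have hΨC : ∀ a : O, Ψ (C a) = C a := fun a => by
    rw [hΨdef, substHom_apply, aeval_C, algebraMap_eq]
  have hΨX : ∀ l, Ψ (X l) = Θ l := fun l => by
    rw [hΨdef, substHom_apply, aeval_X]
  have hc : P.comap Ψ = P := by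
    rw [hP, hΨdef]
    exact comap_substHom_secIdeal Θ h0
  set 𝔫 : Ideal (MvPolynomial (Fin n) O) := P.comap Ψ with h𝔫
  set A := Localization.AtPrime 𝔫
  set B := Localization.AtPrime P
  set f : A →+* B := Localization.localRingHom 𝔫 P Ψ rfl with hfdef
  letI : Algebra A B := f.toAlgebra
  have hf : algebraMap A B = f := rfl
  haveI : IsLocalHom (algebraMap A B) := by
    rw [hf, hfdef]
    infer_instance
  haveI : IsScalarTower O A B := by
    refine IsScalarTower.of_algebraMap_eq fun c => ?_
    rw [hf, IsScalarTower.algebraMap_apply O (MvPolynomial (Fin n) O) A c, hfdef, Localization.localRingHom_to_map,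
      IsScalarTower.algebraMap_apply O (MvPolynomial (Fin n) O) B c]
    congr 1
    rw [MvPolynomial.algebraMap_eq]
    exact (hΨC c).symm
  -- images of the generators
  have hgenA : ∀ r : MvPolynomial (Fin n) O, r ∈ P → Ψ r = r → algebraMap (MvPolynomial (Fin n) O) B r ∈ (IsLocalRing.maximalIdeal A).map (algebraMap A B) := by
    intro r hr hΨr
    have h1 : algebraMap (MvPolynomial (Fin n) O) A r ∈ IsLocalRing.maximalIdeal A := by
      rw [← Localization.AtPrime.map_eq_maximalIdeal]
      refine Ideal.mem_map_of_mem _ ?_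
      show r ∈ P.comap Ψ
      rw [Ideal.mem_comap, hΨr]
      exact hr
    have h2 : algebraMap A B (algebraMap (MvPolynomial (Fin n) O) A r) = algebraMap (MvPolynomial (Fin n) O) B (Ψ r) := by
      rw [hf, hfdef, Localization.localRingHom_to_map]
    rw [hΨr] at h2
    rw [← h2]
    exact Ideal.mem_map_of_mem _ h1
  have hgenX : ∀ l, algebraMap (MvPolynomial (Fin n) O) B (Θ l) ∈ (IsLocalRing.maximalIdeal A).map (algebraMap A B) := by
    intro l
    have h1 : algebraMap (MvPolynomial (Fin n) O) A (X l) ∈ IsLocalRing.maximalIdeal A := by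
      rw [← Localization.AtPrime.map_eq_maximalIdeal]
      refine Ideal.mem_map_of_mem _ ?_
      show X l ∈ P.comap Ψ
      rw [Ideal.mem_comap, hΨX, hP]
      exact mem_secIdeal_of_constantCoeff (h0 l)
    have h2 : algebraMap A B (algebraMap (MvPolynomial (Fin n) O) A (X l)) = algebraMap (MvPolynomial (Fin n) O) B (Ψ (X l)) := by
      rw [hf, hfdef, Localization.localRingHom_to_map]
    rw [hΨX] at h2
    rw [← h2]
    exact Ideal.mem_map_of_mem _ h1
  -- `𝔫 B = 𝔪 B`
  have hmax : (IsLocalRing.maximalIdeal A).map (algebraMap A B) = IsLocalRing.maximalIdeal B := by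
    apply le_antisymm
    · exact ((IsLocalRing.local_hom_TFAE (algebraMap A B)).out 0 2 rfl rfl).mp ‹_›
    · have hX := X_mem_span_sup_sq Θ h0 hdet
      rw [maximalIdeal_atSection_eq_map Θ h0 hX P hP, Ideal.map_le_iff_le_comap, sup_le_iff, Ideal.map_le_iff_le_comap,
        Ideal.span_le]
      refine ⟨fun a ha => ?_, ?_⟩
      · rw [Ideal.mem_comap, Ideal.mem_comap]
        exact hgenA (C a) (hP ▸ C_mem_secIdeal ha) (hΨC a)
      · rintro _ ⟨l, rfl⟩
        exact hgenX l
  -- (i) unramified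
  have hur : Algebra.FormallyUnramified A B := by
    haveI : Algebra.EssFiniteType O B := Algebra.EssFiniteType.comp O (MvPolynomial (Fin n) O) B
    haveI : Algebra.EssFiniteType A B := Algebra.EssFiniteType.of_comp O A B
    haveI : Algebra.IsSeparable (IsLocalRing.ResidueField A) (IsLocalRing.ResidueField B) := by
      refine ⟨fun x => ?_⟩
      obtain ⟨q, rfl⟩ := (Ideal.algebraMap_residueField_surjective P) x
      -- `q ≡ C (constantCoeff q)` modulo `𝔪`
      have hq : algebraMap (MvPolynomial (Fin n) O) (IsLocalRing.ResidueField B) q = algebraMap (MvPolynomial (Fin n) O) (IsLocalRing.ResidueField B) (C (constantCoeff q)) := by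
        rw [← sub_eq_zero, ← map_sub, IsScalarTower.algebraMap_apply (MvPolynomial (Fin n) O) B (IsLocalRing.ResidueField B), IsLocalRing.ResidueField.algebraMap_eq,
          IsLocalRing.residue_eq_zero_iff, ← Localization.AtPrime.map_eq_maximalIdeal]
        refine Ideal.mem_map_of_mem _ ?_
        rw [hP]
        exact mem_secIdeal_of_constantCoeff (by rw [map_sub, constantCoeff_C, sub_self])
      have hy : algebraMap (MvPolynomial (Fin n) O) (IsLocalRing.ResidueField B) (C (constantCoeff q)) =
          algebraMap (IsLocalRing.ResidueField A) (IsLocalRing.ResidueField B)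
            (IsLocalRing.residue A (algebraMap (MvPolynomial (Fin n) O) A (C (constantCoeff q)))) := by
        rw [IsScalarTower.algebraMap_apply (MvPolynomial (Fin n) O) B (IsLocalRing.ResidueField B), IsLocalRing.ResidueField.algebraMap_eq]
        show _ = IsLocalRing.ResidueField.map (algebraMap A B) (IsLocalRing.residue A (algebraMap (MvPolynomial (Fin n) O) A (C (constantCoeff q))))
        rw [IsLocalRing.ResidueField.map_residue, hf, hfdef, Localization.localRingHom_to_map, hΨC]
      change IsSeparable (IsLocalRing.ResidueField A) (algebraMap (MvPolynomial (Fin n) O) (IsLocalRing.ResidueField B) q)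
      rw [hq, hy]
      exact isSeparable_algebraMap _
    exact Algebra.FormallyUnramified.of_map_maximalIdeal hmax
  -- (ii) flat (Matsumura 23.1, regular fibre of dimension `0`)
  have hfl : Module.Flat A B := by
    have hF : IsRegularLocalRing (B ⧸ (IsLocalRing.maximalIdeal A).map (algebraMap A B)) := by
      rw [hmax]
      letI := Ideal.Quotient.field (IsLocalRing.maximalIdeal B)
      infer_instance
    have hdim : ringKrullDim A + ringKrullDim (B ⧸ (IsLocalRing.maximalIdeal A).map (algebraMap A B)) ≤ ringKrullDim B := by
      rw [hmax]
      have h0' : ringKrullDim (B ⧸ IsLocalRing.maximalIdeal B) = 0 := by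
        letI := Ideal.Quotient.field (IsLocalRing.maximalIdeal B)
        exact ringKrullDim_eq_zero_of_field _
      rw [h0', add_zero, IsLocalization.AtPrime.ringKrullDim_eq_height 𝔫 A, IsLocalization.AtPrime.ringKrullDim_eq_height P B]
      rw [hc]
    haveI : IsNoetherianRing B := IsLocalization.isNoetherianRing P.primeCompl _ inferInstance
    exact Literature.RingTheory.Flat.flat_of_isRegularLocalRing_of_isRegularLocalRing_fiber hF hdim
  exact ⟨hfl, hur⟩

end EtaleProof

/-! ### 12.15 (B1) AT SCHEME LEVEL: `Spec Ψ : 𝔸ⁿ_O → 𝔸ⁿ_O` is ÉTALE on an open neighbourhood of the section point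

EGA IV₄ 17.6.1 c) ⇒ a) (tree `Literature.AlgebraicGeometry.Resolution.exists_etale_ι_comp_of_flat_of_formallyUnramified_stalkMap`) applied to
`etaleAtSection` through Mathlib's `Scheme.arrowStalkMapSpecIso` (the stalk map of `Spec Ψ` at `𝔪` IS the local homomorphism of §12.13). -/
section EtaleChart

variable {O : Type} [CommRing O]

open AlgebraicGeometry CategoryTheory

/-- `Spec Φ : 𝔸^τ_O → 𝔸^σ_O` is locally of finite presentation for every `O`-algebra map `Φ : O[y_σ] → O[x_τ]`. [folklore; the field case is the
tree's `locallyOfFinitePresentation_specMap_algHom`] -/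
theorem locallyOfFinitePresentation_specMap_algHom_base {σ τ : Type} [Finite σ] [Finite τ]
    (Φ : MvPolynomial σ O →ₐ[O] MvPolynomial τ O) :
    LocallyOfFinitePresentation (Spec.map (CommRingCat.ofHom Φ.toRingHom)) := by
  rw [HasRingHomProperty.Spec_iff (P := @LocallyOfFinitePresentation)]
  letI : Algebra (MvPolynomial σ O) (MvPolynomial τ O) := Φ.toRingHom.toAlgebra
  haveI : IsScalarTower O (MvPolynomial σ O) (MvPolynomial τ O) :=
    IsScalarTower.of_algebraMap_eq fun c => by
      change algebraMap O (MvPolynomial τ O) c = Φ (algebraMap O (MvPolynomial σ O) c)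
      exact (Φ.commutes c).symm
  have : Algebra.FinitePresentation (MvPolynomial σ O) (MvPolynomial τ O) :=
    Algebra.FinitePresentation.of_restrict_scalars_finitePresentation O _ _
  exact this

/-- **(B1) at scheme level.**  For a regular local ring `O` and `Θ₁, …, Θₙ ∈ O[t]` with zero constant terms and invertible Jacobian at the section,
`Spec Ψ : 𝔸ⁿ_O → 𝔸ⁿ_O` (`Ψ : uⱼ ↦ Θⱼ`) is ÉTALE on some open neighbourhood `U` of the section point `𝔪 = 𝔪_O·O[t] + (t)`: `U ↪ 𝔸ⁿ_O → 𝔸ⁿ_O` is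
`AlgebraicGeometry.Etale`.  This is the map along which the standard toric `O`-tower is pulled back in `nd_rung_local` ((O1)/(B1) of the card).
[OURS · L1 W4.5b; EGA IV₄ 17.6.1 via the tree] -/
theorem exists_etale_nhd_atSection (n : ℕ) (O : Type) [CommRing O] [IsRegularLocalRing O] (Θ : Fin n → MvPolynomial (Fin n) O)
    (h0 : ∀ l, constantCoeff (Θ l) = 0) (hdet : IsUnit (jacO Θ).det) :
    ∃ U : (Spec (CommRingCat.of (MvPolynomial (Fin n) O))).Opens,
      (⟨secIdeal n O, (isMaximal_secIdeal (n := n) (O := O)).isPrime⟩ : PrimeSpectrum (MvPolynomial (Fin n) O)) ∈ U ∧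
      Etale (U.ι ≫ Spec.map (CommRingCat.ofHom (substHom Θ))) := by
  haveI : (secIdeal n O).IsPrime := (isMaximal_secIdeal (n := n) (O := O)).isPrime
  obtain ⟨hfl, hur⟩ := etaleAtSection n O Θ h0 hdet (secIdeal n O) rfl
  set φ : Spec (CommRingCat.of (MvPolynomial (Fin n) O)) ⟶ Spec (CommRingCat.of (MvPolynomial (Fin n) O)) :=
    Spec.map (CommRingCat.ofHom (substHom Θ)) with hφ
  set z : Spec (CommRingCat.of (MvPolynomial (Fin n) O)) := ⟨secIdeal n O, (isMaximal_secIdeal (n := n) (O := O)).isPrime⟩ with hz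
  haveI : LocallyOfFinitePresentation φ :=
    locallyOfFinitePresentation_specMap_algHom_base (aeval Θ : MvPolynomial (Fin n) O →ₐ[O] MvPolynomial (Fin n) O)
  have hfl' : (φ.stalkMap z).hom.Flat :=
    (RingHom.Flat.respectsIso.arrow_mk_iso_iff (Scheme.arrowStalkMapSpecIso (CommRingCat.ofHom (substHom Θ)) z)).mpr hfl
  have hur' : (φ.stalkMap z).hom.FormallyUnramified :=
    (RingHom.FormallyUnramified.respectsIso.arrow_mk_iso_iff (Scheme.arrowStalkMapSpecIso (CommRingCat.ofHom (substHom Θ)) z)).mpr hur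
  exact Literature.AlgebraicGeometry.Resolution.exists_etale_ι_comp_of_flat_of_formallyUnramified_stalkMap φ z hfl' hur'

end EtaleChart

end ChartDictionary

open CategoryTheory AlgebraicGeometry TopologicalSpace Opposite
open Scheme.IdealSheafData
open Literature.AlgebraicGeometry.Resolution

/-! ### 12.16 (B2) — the coordinate blow-up charts of `𝔸ⁿ_S` along `V(xᵢ : i ∈ Λ)` over ANY base ring `S`

The tree's `Literature…AffineCoordinateBlowupCharts` is stated over a FIELD `K` (it routes through the origin `ξ` and the
reduced ideal sheaf of the closed set `C_Λ`).  The O-tower of `nd_rung_local` needs the same charts over the base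
`S = O` (a DVR) — and in fact over any commutative ring: the centre is the ideal sheaf of the IDEAL `I_Λ = (xᵢ : i ∈ Λ)`
(`affineBlowup.idealSheaf`), the ring level is the tree's `CoordinateBlowupChart.coordBlowupChartEquiv S Λ i` (any `S`),
and the transport is the tree's `IsBlowup.exists_chart_of_ringEquiv`.  Result: for ANY blowing up `π : W → 𝔸ⁿ_S` of
`I_Λ·𝒪` and `i ∈ Λ` an OPEN IMMERSION `chartImmS hπ hi : 𝔸ⁿ_S → W` onto the principal chart `W[⊤, xᵢ]` with
`chartImmS ≫ π = Spec (coordBlowupSubst S Λ i)`, the `|Λ|` charts cover `W`, `W → Spec S` is SMOOTH (hence flat), and a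
model exists (`affineBlowup.isBlowup`).  [OURS · L1 W4.5b] -/
section CoordChartsBase

universe u

variable (n : ℕ) (S : Type u) [CommRing S] (Λ : Set (Fin n))

/-- `𝔸ⁿ_S = Spec S[x₁, …, xₙ]`. -/
abbrev PS : Scheme.{u} := Spec (.of (MvPolynomial (Fin n) S))

/-- The structure map `𝔸ⁿ_S → Spec S`. -/
def fS : PS n S ⟶ Spec (.of S) := Spec.map (CommRingCat.ofHom (algebraMap S (MvPolynomial (Fin n) S)))

/-- `I_Λ = (xᵢ : i ∈ Λ) ⊆ S[x]`. -/
def IΛS : Ideal (MvPolynomial (Fin n) S) := Ideal.span (X '' Λ)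

/-- The ideal sheaf `I_Λ · 𝒪` on `𝔸ⁿ_S` (NOT the vanishing ideal of a closed set: `S` is arbitrary). -/
def 𝓘ΛS : (PS n S).IdealSheafData := affineBlowup.idealSheaf (IΛS n S Λ)

/-- The top affine open of `𝔸ⁿ_S`. -/
abbrev WtopS : (PS n S).affineOpens := ⟨⊤, isAffineOpen_top _⟩

/-- `γ : Γ(𝔸ⁿ_S, ⊤) ≅ S[x]`. -/
def γS : Γ(PS n S, WtopS n S) ≃+* MvPolynomial (Fin n) S :=
  (Scheme.ΓSpecIso (.of (MvPolynomial (Fin n) S))).commRingCatIsoToRingEquiv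

/-- The coordinate sections `γ⁻¹ xᵢ ∈ Γ(𝔸ⁿ_S, ⊤)`. -/
def coordS (i : Fin n) : Γ(PS n S, WtopS n S) := (γS n S).symm (X i)

@[simp] theorem γS_coordS (i : Fin n) : γS n S (coordS n S i) = X i := (γS n S).apply_symm_apply _

theorem γS_symm_apply (a : MvPolynomial (Fin n) S) :
    (γS n S).symm a = (Scheme.ΓSpecIso (.of (MvPolynomial (Fin n) S))).inv.hom a := rfl

/-- `𝓘_Λ(⊤) = γ⁻¹ I_Λ`. -/
theorem ideal_𝓘ΛS_top :
    (𝓘ΛS n S Λ).ideal (WtopS n S) =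
      (IΛS n S Λ).map (Scheme.ΓSpecIso (.of (MvPolynomial (Fin n) S))).inv.hom :=
  ideal_ofIdealTop_top _

/-- Under `γ`, `𝓘_Λ(⊤)` is `I_Λ`. -/
theorem map_ideal_𝓘ΛS_top : ((𝓘ΛS n S Λ).ideal (WtopS n S)).map (γS n S).toRingHom = IΛS n S Λ := by
  rw [ideal_𝓘ΛS_top, Ideal.map_map]
  have : (γS n S).toRingHom.comp (Scheme.ΓSpecIso (.of (MvPolynomial (Fin n) S))).inv.hom = RingHom.id _ := by
    refine RingHom.ext fun a => ?_
    change γS n S ((γS n S).symm a) = a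
    exact (γS n S).apply_symm_apply a
  rw [this, Ideal.map_id]

/-- `𝓘_Λ(⊤)` is spanned by the coordinate sections `γ⁻¹ xᵢ`, `i ∈ Λ`. -/
theorem ideal_𝓘ΛS_top_eq_span :
    Ideal.span (Set.range fun i : Λ => coordS n S (i : Fin n)) = (𝓘ΛS n S Λ).ideal (WtopS n S) := by
  rw [ideal_𝓘ΛS_top, IΛS, Ideal.map_span, Set.image_image]
  congr 1
  ext s
  constructor
  · rintro ⟨⟨i, hi⟩, rfl⟩
    exact ⟨i, hi, (γS_symm_apply n S (X i)).symm⟩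
  · rintro ⟨i, hi, rfl⟩
    exact ⟨⟨i, hi⟩, γS_symm_apply n S (X i)⟩

/-- `γ⁻¹ xᵢ ∈ 𝓘_Λ(⊤)` for `i ∈ Λ`. -/
theorem coordS_mem {i : Fin n} (hi : i ∈ Λ) : coordS n S i ∈ (𝓘ΛS n S Λ).ideal (WtopS n S) := by
  rw [← ideal_𝓘ΛS_top_eq_span]
  exact Ideal.subset_span ⟨⟨i, hi⟩, rfl⟩

/-- `𝓘_Λ ≠ ⊥` as soon as `Λ` is nonempty and `S` is nontrivial. -/
theorem 𝓘ΛS_ne_bot [Nontrivial S] (hΛ : Λ.Nonempty) : 𝓘ΛS n S Λ ≠ ⊥ := by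
  obtain ⟨i, hi⟩ := hΛ
  intro h
  have hmem := coordS_mem n S Λ hi
  rw [h] at hmem
  have h0 : coordS n S i = 0 := by simpa using hmem
  have := congrArg (γS n S) h0
  rw [γS_coordS, map_zero] at this
  exact X_ne_zero i this

/-- `Spec Γ(𝔸ⁿ_S, ⊤) → 𝔸ⁿ_S` is `Spec` of `ΓSpecIso⁻¹`. -/
theorem fromSpec_WtopS :
    (WtopS n S).2.fromSpec = Spec.map (Scheme.ΓSpecIso (.of (MvPolynomial (Fin n) S))).inv := by
  change (isAffineOpen_top (PS n S)).fromSpec = _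
  rw [IsAffineOpen.fromSpec_top, Scheme.isoSpec_Spec_inv]

/-- For a ring map `φ : S[x] → T`: `Spec (φ ∘ γ) ≫ (Spec Γ(𝔸ⁿ_S, ⊤) → 𝔸ⁿ_S) = Spec φ`. -/
theorem specMap_comp_γS_fromSpec {T : Type u} [CommRing T] (φ : MvPolynomial (Fin n) S →+* T) :
    Spec.map (CommRingCat.ofHom (φ.comp (γS n S).toRingHom)) ≫ (WtopS n S).2.fromSpec =
      Spec.map (CommRingCat.ofHom φ) := by
  have e1 : CommRingCat.ofHom (φ.comp (γS n S).toRingHom) =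
      (Scheme.ΓSpecIso (.of (MvPolynomial (Fin n) S))).hom ≫ CommRingCat.ofHom φ := by
    apply CommRingCat.hom_ext
    exact RingHom.ext fun a => rfl
  have e2 : Spec.map (CommRingCat.ofHom (φ.comp (γS n S).toRingHom)) =
      Spec.map (CommRingCat.ofHom φ) ≫ Spec.map (Scheme.ΓSpecIso (.of (MvPolynomial (Fin n) S))).hom := by
    rw [← Spec.map_comp, ← e1]
  rw [fromSpec_WtopS, e2, Category.assoc, ← Spec.map_comp, Iso.inv_hom_id, Spec.map_id, Category.comp_id]

/-- A MODEL: the affine blowing up `Bl_{I_Λ} 𝔸ⁿ_S → 𝔸ⁿ_S` is a blowing up of `𝓘_Λ`. -/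
theorem isBlowup_model : IsBlowup (affineBlowup.π (IΛS n S Λ)) (𝓘ΛS n S Λ) :=
  affineBlowup.isBlowup (IΛS n S Λ)

variable (i : Fin n)

/-- The chart ring isomorphism `S[x] ≅ S[x][I_Λ/xᵢ]` of the tree's `CoordinateBlowupChart.lean`, as a ring isomorphism. -/
def chartRingEquivS : MvPolynomial (Fin n) S ≃+* blowupAlgebra (IΛS n S Λ) (X i : MvPolynomial (Fin n) S) :=
  (coordBlowupChartEquiv S Λ i).toRingEquiv

theorem chartRingEquivS_symm_algebraMap (a : MvPolynomial (Fin n) S) :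
    (chartRingEquivS n S Λ i).symm
        (algebraMap (MvPolynomial (Fin n) S) (blowupAlgebra (IΛS n S Λ) (X i : MvPolynomial (Fin n) S)) a) =
      coordBlowupSubst S Λ i a :=
  coordBlowupChartEquiv_symm_algebraMap S Λ i a

variable {n S}
variable {W : Scheme.{u}} (π : W ⟶ PS n S)

/-- The principal chart `W[⊤, xᵢ]` of `π` for `𝓘_Λ`. -/
def chartS (i : Fin n) : W.Opens := blowupChart π (𝓘ΛS n S Λ) (WtopS n S) (coordS n S i)

theorem chartS_le (i : Fin n) : chartS Λ π i ≤ π ⁻¹ᵁ ((WtopS n S) : (PS n S).Opens) :=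
  blowupChart_le_preimage π (𝓘ΛS n S Λ) (WtopS n S) (coordS n S i)

variable {Λ π} (hπ : IsBlowup π (𝓘ΛS n S Λ))
include hπ

/-- The charts at the centre variables are affine. -/
theorem isAffineOpen_chartS {i : Fin n} (hi : i ∈ Λ) : IsAffineOpen (chartS Λ π i) :=
  hπ.isAffineOpen_blowupChart (coordS_mem n S Λ hi)

/-- **The `|Λ|` charts cover the blow-up.** -/
theorem iSup_chartS : ⨆ i : Λ, chartS Λ π (i : Fin n) = ⊤ := by
  have h := hπ.iSup_blowupChart (fun i : Λ => coordS n S (i : Fin n)) (ideal_𝓘ΛS_top_eq_span n S Λ)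
  change ⨆ i : Λ, blowupChart π (𝓘ΛS n S Λ) (WtopS n S) (coordS n S (i : Fin n)) = ⊤
  rw [h]
  exact π.preimage_top

/-- The raw `i`-th chart `Spec S[x][I_Λ/xᵢ] → W` (Stacks 0804 transported along `γ`). -/
theorem exists_rawChartS {i : Fin n} (hi : i ∈ Λ) :
    ∃ (c : Spec (.of (blowupAlgebra (IΛS n S Λ) (X i : MvPolynomial (Fin n) S))) ⟶ W) (_ : IsOpenImmersion c),
      c.opensRange = chartS Λ π i ∧
        c ≫ π = Spec.map (CommRingCat.ofHom
          ((algebraMap (MvPolynomial (Fin n) S) (blowupAlgebra (IΛS n S Λ) (X i : MvPolynomial (Fin n) S))).comp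
            (γS n S).toRingHom)) ≫ (WtopS n S).2.fromSpec :=
  hπ.exists_chart_of_ringEquiv (WtopS n S) (coordS_mem n S Λ hi) (γS n S) (IΛS n S Λ) (X i)
    (map_ideal_𝓘ΛS_top n S Λ) (γS_coordS n S i)

/-- **The `i`-th chart `chartImmS hπ hi : 𝔸ⁿ_S ⟶ W`** (`i ∈ Λ`). -/
def chartImmS {i : Fin n} (hi : i ∈ Λ) : PS n S ⟶ W :=
  Spec.map (chartRingEquivS n S Λ i).symm.toCommRingCatIso.hom ≫ (exists_rawChartS hπ hi).choose

/-- The chart is an open immersion. -/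
theorem isOpenImmersion_chartImmS {i : Fin n} (hi : i ∈ Λ) : IsOpenImmersion (chartImmS hπ hi) := by
  haveI := (exists_rawChartS hπ hi).choose_spec.choose
  exact inferInstanceAs
    (IsOpenImmersion (Spec.map (chartRingEquivS n S Λ i).symm.toCommRingCatIso.hom ≫ (exists_rawChartS hπ hi).choose))

/-- **The image of the `i`-th chart is the principal chart `W[⊤, xᵢ]`.** -/
theorem opensRange_chartImmS {i : Fin n} (hi : i ∈ Λ) :
    @Scheme.Hom.opensRange _ _ (chartImmS hπ hi) (isOpenImmersion_chartImmS hπ hi) = chartS Λ π i := by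
  haveI := (exists_rawChartS hπ hi).choose_spec.choose
  change (Spec.map (chartRingEquivS n S Λ i).symm.toCommRingCatIso.hom ≫ (exists_rawChartS hπ hi).choose).opensRange = _
  rw [Scheme.Hom.opensRange_comp_of_isIso]
  exact (exists_rawChartS hπ hi).choose_spec.choose_spec.1

/-- **The chart map in coordinates: `chartImmS hπ hi ≫ π = Spec (coordBlowupSubst S Λ i)`** —
`xᵢ ↦ yᵢ`, `xⱼ ↦ yᵢ·yⱼ` (`j ∈ Λ ∖ {i}`), `xⱼ ↦ yⱼ` (`j ∉ Λ`). -/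
theorem chartImmS_comp {i : Fin n} (hi : i ∈ Λ) :
    chartImmS hπ hi ≫ π = Spec.map (CommRingCat.ofHom (coordBlowupSubst S Λ i).toRingHom) := by
  change (Spec.map (chartRingEquivS n S Λ i).symm.toCommRingCatIso.hom ≫ (exists_rawChartS hπ hi).choose) ≫ π = _
  rw [Category.assoc, (exists_rawChartS hπ hi).choose_spec.choose_spec.2, specMap_comp_γS_fromSpec,
    ← Spec.map_comp]
  congr 1
  apply CommRingCat.hom_ext
  refine RingHom.ext fun a => ?_
  change (chartRingEquivS n S Λ i).symm
      (algebraMap (MvPolynomial (Fin n) S) (blowupAlgebra (IΛS n S Λ) (X i : MvPolynomial (Fin n) S)) a) =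
    coordBlowupSubst S Λ i a
  exact chartRingEquivS_symm_algebraMap n S Λ i a

/-- **Over `Spec S` the chart is the identity of `𝔸ⁿ_S`:** `chartImmS hπ hi ≫ π ≫ f = f`. -/
theorem chartImmS_comp_fS {i : Fin n} (hi : i ∈ Λ) : chartImmS hπ hi ≫ π ≫ fS n S = fS n S := by
  rw [← Category.assoc, chartImmS_comp, fS, ← Spec.map_comp]
  congr 1
  apply CommRingCat.hom_ext
  refine RingHom.ext fun c => ?_
  change coordBlowupSubst S Λ i (algebraMap S (MvPolynomial (Fin n) S) c) = algebraMap S (MvPolynomial (Fin n) S) c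
  exact (coordBlowupSubst S Λ i).commutes c

/-- Every point of `W` lies in the image of some chart `i ∈ Λ`. -/
theorem exists_mem_range_chartImmS (w : W) : ∃ i : Λ, w ∈ Set.range (chartImmS hπ i.2).base := by
  have hw : w ∈ (⊤ : W.Opens) := trivial
  rw [← iSup_chartS hπ, Opens.mem_iSup] at hw
  obtain ⟨i, hi⟩ := hw
  refine ⟨i, ?_⟩
  rw [← opensRange_chartImmS hπ i.2] at hi
  exact hi

/-- **The open cover of `W` by `|Λ|` affine spaces `𝔸ⁿ_S`.** -/
def chartCoverS : Scheme.OpenCover.{0} W :=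
  Scheme.Cover.mkOfCovers (↥Λ) (fun _ => PS n S) (fun i => chartImmS hπ i.2)
    (fun w => by
      obtain ⟨i, y, hy⟩ := exists_mem_range_chartImmS hπ w
      exact ⟨i, y, hy⟩)
    fun i => isOpenImmersion_chartImmS hπ i.2

omit hπ in
/-- `𝔸ⁿ_S → Spec S` is smooth (any base ring). -/
theorem smooth_fS : Smooth (fS n S) := by
  haveI : Algebra.Smooth S (MvPolynomial (Fin n) S) := {}
  rw [fS, HasRingHomProperty.Spec_iff (P := @Smooth), CommRingCat.hom_ofHom, RingHom.smooth_algebraMap]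
  infer_instance

omit hπ in
/-- **A blow-up of `𝔸ⁿ_S` along `V(xᵢ : i ∈ Λ)` is SMOOTH over `S`** — every base ring `S`, every `Λ`. -/
theorem smooth_compS (hπ : IsBlowup π (𝓘ΛS n S Λ)) : Smooth (π ≫ fS n S) :=
  (IsZariskiLocalAtSource.iff_of_openCover (P := @Smooth) (chartCoverS hπ)).mpr fun i => by
    change Smooth (chartImmS hπ i.2 ≫ π ≫ fS n S)
    rw [chartImmS_comp_fS]
    exact smooth_fS

omit hπ in
/-- … hence FLAT over `S` (the O-flatness clause of `ELNatConclusionO` for the ambient tower members). -/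
theorem flat_compS (hπ : IsBlowup π (𝓘ΛS n S Λ)) : Flat (π ≫ fS n S) := by
  haveI := smooth_compS hπ
  infer_instance

omit hπ in
/-- … and proper over `𝔸ⁿ_S`. -/
theorem isProper_of_isBlowupS [IsNoetherianRing S] (hπ : IsBlowup π (𝓘ΛS n S Λ)) : IsProper π := hπ.isProper

/-- **Each chart is an affine space, in sections**: `Γ(W, W[⊤, xᵢ]) ≅ S[x]` with `π^* s ↦ coordBlowupSubst S Λ i (γ s)`. -/
theorem exists_chartEquivS {i : Fin n} (hi : i ∈ Λ) :
    ∃ Φ : Γ(W, chartS Λ π i) ≃+* MvPolynomial (Fin n) S,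
      ∀ s, Φ ((π.appLE (WtopS n S) (chartS Λ π i) (chartS_le Λ π i)).hom s) =
        coordBlowupSubst S Λ i (γS n S s) := by
  obtain ⟨e, he⟩ := hπ.exists_ringEquiv_blowupChart (WtopS n S) (coordS_mem n S Λ hi)
  let Φ₀ : Γ(W, chartS Λ π i) ≃+* blowupAlgebra (((𝓘ΛS n S Λ).ideal (WtopS n S)).map (γS n S).toRingHom)
      (γS n S (coordS n S i)) :=
    e.trans (blowupAlgebra.congrEquiv (γS n S) ((𝓘ΛS n S Λ).ideal (WtopS n S)) (coordS n S i))
  have hΦ₀ : ∀ s, Φ₀ ((π.appLE (WtopS n S) (chartS Λ π i) (chartS_le Λ π i)).hom s) =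
      algebraMap _ _ (γS n S s) := fun s =>
    (congrArg (blowupAlgebra.congrEquiv (γS n S) ((𝓘ΛS n S Λ).ideal (WtopS n S)) (coordS n S i)) (he s)).trans
      (blowupAlgebra.congrEquiv_algebraMap (γS n S) _ _ s)
  have hJ := map_ideal_𝓘ΛS_top n S Λ
  have ha := γS_coordS n S i
  clear_value Φ₀
  revert Φ₀
  rw [hJ, ha]
  intro Φ₀ hΦ₀
  refine ⟨Φ₀.trans (chartRingEquivS n S Λ i).symm, fun s => ?_⟩
  exact (congrArg (chartRingEquivS n S Λ i).symm (hΦ₀ s)).trans (chartRingEquivS_symm_algebraMap n S Λ i _)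

end CoordChartsBase

/-! #### 12.16 (b) — base change of the charts along `f : S → T` (e.g. `O → k = O/𝔪`, `O → Frac O`)

The chart substitution and the centre ideal commute with `MvPolynomial.map f`; so the `i`-th chart square
`𝔸ⁿ_T → 𝔸ⁿ_T` over `𝔸ⁿ_S → 𝔸ⁿ_S` commutes for EVERY ring map `f` (no flatness needed: both chart rings are polynomial
rings over their bases, compatibly).  This is the chart-level identification of the special / generic fibre of the
O-tower member with the corresponding k- / K-tower member used in (B4).  [OURS · L1 W4.5b] -/
section CoordChartsBaseChange

universe u

variable {n : ℕ} {S T : Type u} [CommRing S] [CommRing T] (f : S →+* T) (Λ : Set (Fin n)) (i : Fin n)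

/-- `map f ∘ coordBlowupSubst_S = coordBlowupSubst_T ∘ map f`. -/
theorem map_comp_coordBlowupSubst :
    (MvPolynomial.map f).comp (coordBlowupSubst S Λ i).toRingHom =
      (coordBlowupSubst T Λ i).toRingHom.comp (MvPolynomial.map f) := by
  refine MvPolynomial.ringHom_ext (fun c => ?_) (fun j => ?_)
  · change MvPolynomial.map f (coordBlowupSubst S Λ i (C c)) = coordBlowupSubst T Λ i (MvPolynomial.map f (C c))
    rw [coordBlowupSubst_C, map_C, coordBlowupSubst_C]
  · change MvPolynomial.map f (coordBlowupSubst S Λ i (X j)) = coordBlowupSubst T Λ i (MvPolynomial.map f (X j))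
    rw [coordBlowupSubst_X, map_X, coordBlowupSubst_X]
    by_cases h : j ∈ Λ ∧ j ≠ i
    · rw [if_pos h, if_pos h, map_mul, map_X, map_X]
    · rw [if_neg h, if_neg h, map_X]

/-- The centre ideal base-changes: `I_Λ,S · T[x] = I_Λ,T`. -/
theorem map_IΛS : (IΛS n S Λ).map (MvPolynomial.map f) = IΛS n T Λ := by
  rw [IΛS, IΛS, Ideal.map_span, Set.image_image]
  congr 1
  ext a
  constructor
  · rintro ⟨j, hj, rfl⟩
    exact ⟨j, hj, (map_X f j).symm⟩
  · rintro ⟨j, hj, rfl⟩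
    exact ⟨j, hj, map_X f j⟩

/-- **The chart square commutes**: `Spec (coordBlowupSubst T Λ i) ≫ (𝔸ⁿ_T → 𝔸ⁿ_S) = (𝔸ⁿ_T → 𝔸ⁿ_S) ≫ Spec (coordBlowupSubst S Λ i)`. -/
theorem specMap_coordBlowupSubst_comp_specMap_map :
    Spec.map (CommRingCat.ofHom (coordBlowupSubst T Λ i).toRingHom) ≫
        Spec.map (CommRingCat.ofHom (MvPolynomial.map (σ := Fin n) f)) =
      Spec.map (CommRingCat.ofHom (MvPolynomial.map (σ := Fin n) f)) ≫
        Spec.map (CommRingCat.ofHom (coordBlowupSubst S Λ i).toRingHom) := by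
  rw [← Spec.map_comp, ← Spec.map_comp]
  congr 1
  apply CommRingCat.hom_ext
  change (coordBlowupSubst T Λ i).toRingHom.comp (MvPolynomial.map f) =
    (MvPolynomial.map f).comp (coordBlowupSubst S Λ i).toRingHom
  exact (map_comp_coordBlowupSubst f Λ i).symm

/-- The structure maps are compatible: `(𝔸ⁿ_T → 𝔸ⁿ_S) ≫ f_S = f_T ≫ Spec f`. -/
theorem specMap_map_comp_fS :
    Spec.map (CommRingCat.ofHom (MvPolynomial.map (σ := Fin n) f)) ≫ fS n S =
      fS n T ≫ Spec.map (CommRingCat.ofHom f) := by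
  rw [fS, fS, ← Spec.map_comp, ← Spec.map_comp]
  congr 1
  apply CommRingCat.hom_ext
  change (MvPolynomial.map f).comp (algebraMap S (MvPolynomial (Fin n) S)) =
    (algebraMap T (MvPolynomial (Fin n) T)).comp f
  refine RingHom.ext fun c => ?_
  change MvPolynomial.map f (algebraMap S (MvPolynomial (Fin n) S) c) = algebraMap T (MvPolynomial (Fin n) T) (f c)
  rw [MvPolynomial.algebraMap_eq, MvPolynomial.algebraMap_eq, map_C]

end CoordChartsBaseChange

/-! #### 12.17 — the CENTRES and the MEMBERS of the O-tower in chart coordinates are REGULAR and SMOOTH over the base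

In the chart coordinates `u` over `S` every centre of the toric tower is a coordinate subspace `Z_J = V(u_j : j ∈ J) ⊆ 𝔸ⁿ_S`,
i.e. `Spec (S[u] ⧸ (u_j : j ∈ J)) ≅ 𝔸^{n−|J|}_S`: REGULAR when `S` is a regular ring (`O = W(k)` is) and SMOOTH — hence FLAT — over
`S` always (the two clauses `Scheme.IsRegular C.subscheme` and `Flat (C.subschemeι ≫ … ≫ Spec O)` of `ELNatConclusionO`, chart-locally);
and every blowing up `W` of `𝔸ⁿ_S` along such a centre is REGULAR (covered by affine spaces, §12.16).  [OURS · L1 W4.5b] -/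
section CentresRegular

universe u

variable {n : ℕ} (S : Type u) [CommRing S] (J : Set (Fin n))

open Classical in
/-- `u_i ↦ u_i` (`i ∉ J`), `u_j ↦ 0` (`j ∈ J`): `S[u] → S[u_i : i ∉ J]`. -/
def killVars : MvPolynomial (Fin n) S →ₐ[S] MvPolynomial {i : Fin n // i ∉ J} S :=
  aeval fun i => if h : i ∈ J then 0 else X ⟨i, h⟩

theorem killVars_X_of_mem {i : Fin n} (hi : i ∈ J) : killVars S J (X i) = 0 := by
  classical
  rw [killVars, aeval_X, dif_pos hi]

theorem killVars_X_of_not_mem {i : Fin n} (hi : i ∉ J) : killVars S J (X i) = X ⟨i, hi⟩ := by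
  classical
  rw [killVars, aeval_X, dif_neg hi]

/-- `killVars ∘ rename val = id`: the inclusion of `S[u_i : i ∉ J]` is a section. -/
theorem killVars_comp_rename :
    (killVars S J).comp (rename (Subtype.val : {i : Fin n // i ∉ J} → Fin n)) = AlgHom.id S _ := by
  refine MvPolynomial.algHom_ext fun i => ?_
  rw [AlgHom.comp_apply, rename_X, killVars_X_of_not_mem S J i.2, AlgHom.id_apply]

theorem killVars_surjective : Function.Surjective (killVars S J) := fun g =>
  ⟨rename Subtype.val g, by
    have := congrArg (fun φ => φ g) (killVars_comp_rename S J)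
    simpa using this⟩

open Classical in
/-- `rename val ∘ killVars` is the tree's `xⱼ ↦ 0` endomorphism of `Literature.RingTheory.MvPolynomial.VariableIdeals`. -/
theorem rename_comp_killVars :
    (rename (Subtype.val : {i : Fin n // i ∉ J} → Fin n)).comp (killVars S J) =
      aeval (fun i => if i ∈ J then (0 : MvPolynomial (Fin n) S) else X i) := by
  refine MvPolynomial.algHom_ext fun i => ?_
  rw [AlgHom.comp_apply, aeval_X]
  by_cases hi : i ∈ J
  · rw [killVars_X_of_mem S J hi, map_zero, if_pos hi]
  · rw [killVars_X_of_not_mem S J hi, rename_X, if_neg hi]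

/-- **`ker (killVars) = (u_j : j ∈ J)`.** -/
theorem ker_killVars : RingHom.ker (killVars S J) = IΛS n S J := by
  classical
  rw [IΛS, ← Literature.RingTheory.MvPolynomial.ker_aeval_ite_eq_span J]
  have hinj : Function.Injective (rename (Subtype.val : {i : Fin n // i ∉ J} → Fin n) :
      MvPolynomial {i : Fin n // i ∉ J} S → MvPolynomial (Fin n) S) :=
    rename_injective _ Subtype.val_injective
  ext f
  rw [RingHom.mem_ker, RingHom.mem_ker, ← rename_comp_killVars S J, AlgHom.comp_apply]
  constructor
  · intro h; rw [h, map_zero]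
  · intro h; exact hinj (by rw [h, map_zero])

/-- **`S[u] ⧸ (u_j : j ∈ J) ≅ S[u_i : i ∉ J]`** as `S`-algebras (`IΛS n S J = Ideal.span (X '' J)`, §12.16). -/
def quotSpanXAlgEquiv : (MvPolynomial (Fin n) S ⧸ IΛS n S J) ≃ₐ[S] MvPolynomial {i : Fin n // i ∉ J} S :=
  (Ideal.quotientEquivAlgOfEq S (ker_killVars S J).symm).trans
    (Ideal.quotientKerAlgEquivOfSurjective (killVars_surjective S J))

/-- **The centre ring `S[u] ⧸ (u_j : j ∈ J)` is a REGULAR ring when `S` is.** -/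
theorem isRegularRing_quot_span_X [IsRegularRing S] :
    IsRegularRing (MvPolynomial (Fin n) S ⧸ IΛS n S J) :=
  IsRegularRing.of_ringEquiv (quotSpanXAlgEquiv S J).toRingEquiv.symm

/-- The centre ring is SMOOTH over `S` (any `S`). -/
theorem smooth_quot_span_X : Algebra.Smooth S (MvPolynomial (Fin n) S ⧸ IΛS n S J) :=
  haveI : Algebra.Smooth S (MvPolynomial {i : Fin n // i ∉ J} S) := {}
  Algebra.Smooth.of_equiv (quotSpanXAlgEquiv S J).symm

/-- **The centre `Z_J = Spec (S[u] ⧸ (u_j : j ∈ J))` is a REGULAR scheme when `S` is a regular ring.** -/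
theorem isRegular_Spec_quot_span_X [IsRegularRing S] :
    Scheme.IsRegular (Spec (.of (MvPolynomial (Fin n) S ⧸ IΛS n S J))) :=
  haveI := isRegularRing_quot_span_X S J
  Scheme.isRegular_Spec _

/-- **`Z_J → Spec S` is SMOOTH** (any base ring `S`). -/
theorem smooth_specMap_quot_span_X :
    Smooth (Spec.map (CommRingCat.ofHom (algebraMap S (MvPolynomial (Fin n) S ⧸ IΛS n S J)))) := by
  haveI := smooth_quot_span_X S J
  rw [HasRingHomProperty.Spec_iff (P := @Smooth), CommRingCat.hom_ofHom, RingHom.smooth_algebraMap]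
  infer_instance

/-- … hence `Z_J → Spec S` is FLAT (the O-flatness clause for the centres of the O-tower). -/
theorem flat_specMap_quot_span_X :
    Flat (Spec.map (CommRingCat.ofHom (algebraMap S (MvPolynomial (Fin n) S ⧸ IΛS n S J)))) := by
  haveI := smooth_specMap_quot_span_X S J
  infer_instance

/-- `𝔸ⁿ_S` is a regular scheme when `S` is a regular ring. -/
theorem isRegular_PS [IsRegularRing S] : Scheme.IsRegular (PS n S) := Scheme.isRegular_Spec _

variable {S}

/-- **Every blowing up of `𝔸ⁿ_S` along `V(uᵢ : i ∈ Λ)` is a REGULAR scheme when `S` is a regular ring** (it is covered by affine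
spaces `𝔸ⁿ_S`, §12.16). -/
theorem isRegular_of_isBlowupS [IsRegularRing S] {Λ : Set (Fin n)} {W : Scheme.{u}} {π : W ⟶ PS n S}
    (hπ : IsBlowup π (𝓘ΛS n S Λ)) : Scheme.IsRegular W := by
  intro w
  obtain ⟨i, y, hy⟩ := exists_mem_range_chartImmS hπ w
  haveI := isOpenImmersion_chartImmS hπ i.2
  haveI : IsRegularLocalRing ((PS n S).presheaf.stalk y) := isRegular_PS (n := n) S y
  rw [← hy]
  exact IsRegularLocalRing.of_ringEquiv (asIso ((chartImmS hπ i.2).stalkMap y)).commRingCatIsoToRingEquiv.symm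

end CentresRegular

/-! #### 12.18 — the SPECIAL FIBRE in chart coordinates: the points of `𝔸ⁿ_O` over the closed point are the image of `𝔸ⁿ_k`,
and the special fibre of a centre `Z_J,O` is `Z_J,k`

This is the chart-local reading of the clause `C.support ∩ (… ≫ Spec O)⁻¹ {closedPoint O} ⊆ Y'` of `ELNatConclusionO`: with
§12.16 (b) (`map_IΛS`) the special fibre of the centre `V(u_j : j ∈ J) ⊆ 𝔸ⁿ_O` is the k-centre `V(u_j : j ∈ J) ⊆ 𝔸ⁿ_k`, on which
E1 is the k-side `Bad` criterion of the tree's `…NatNDChartPullback`.  [OURS · L1 W4.5b] -/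
section SpecialFibre

universe u

variable {n : ℕ} {O : Type u} [CommRing O]

/-- On points, `𝔸ⁿ_O → Spec O` is `P ↦ P ∩ O` (`C⁻¹ P`). -/
theorem fS_base_asIdeal (P : PS n O) :
    ((fS n O).base P).asIdeal = P.asIdeal.comap (C : O →+* MvPolynomial (Fin n) O) := rfl

variable {k : Type u} [Field k] (π : O →+* k)

/-- On points, `Spec (map π) : 𝔸ⁿ_k → 𝔸ⁿ_O` is `Q ↦ (map π)⁻¹ Q`. -/
theorem specMap_map_base_asIdeal (Q : PS n k) :
    ((Spec.map (CommRingCat.ofHom (MvPolynomial.map (σ := Fin n) π))).base Q).asIdeal =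
      Q.asIdeal.comap (MvPolynomial.map (σ := Fin n) π) := rfl

/-- The k-centre maps into the O-centre: `I_J,O ≤ (map π)⁻¹ Q ↔ I_J,k ≤ Q`. -/
theorem IΛS_le_comap_iff (J : Set (Fin n)) (Q : PS n k) :
    IΛS n O J ≤ ((Spec.map (CommRingCat.ofHom (MvPolynomial.map (σ := Fin n) π))).base Q).asIdeal ↔
      IΛS n k J ≤ Q.asIdeal := by
  rw [specMap_map_base_asIdeal, ← map_IΛS π J, Ideal.map_le_iff_le_comap]

variable (hπ : Function.Surjective π)
include hπ

/-- The range of `Spec (map π) : 𝔸ⁿ_k → 𝔸ⁿ_O` is `V(𝔪_O · O[u])`, on points: `P` is in the range iff `ker (map π) ≤ P`. -/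
theorem mem_range_specMap_map_iff (P : PS n O) :
    P ∈ Set.range (Spec.map (CommRingCat.ofHom (MvPolynomial.map (σ := Fin n) π))).base ↔
      RingHom.ker (MvPolynomial.map (σ := Fin n) π) ≤ P.asIdeal := by
  have hsurj : Function.Surjective (MvPolynomial.map (σ := Fin n) π) := MvPolynomial.map_surjective π hπ
  have h := range_comap_of_surjective _ (MvPolynomial.map (σ := Fin n) π) hsurj
  have h' : P ∈ Set.range (PrimeSpectrum.comap (MvPolynomial.map (σ := Fin n) π)) ↔
      P ∈ PrimeSpectrum.zeroLocus (RingHom.ker (MvPolynomial.map (σ := Fin n) π) : Set (MvPolynomial (Fin n) O)) := by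
    rw [h]
  exact h'.trans (SetLike.coe_subset_coe)

variable [IsLocalRing O]

/-- A surjection of a local ring onto a field has kernel the maximal ideal. -/
theorem ker_eq_maximalIdeal_of_surjective : RingHom.ker π = IsLocalRing.maximalIdeal O :=
  IsLocalRing.eq_maximalIdeal (RingHom.ker_isMaximal_of_surjective π hπ)

omit hπ in
/-- A point of `𝔸ⁿ_O` lies over the closed point iff its prime contains `𝔪_O · O[u]`. -/
theorem fS_apply_eq_closedPoint_iff (P : PS n O) :
    (fS n O).base P = IsLocalRing.closedPoint O ↔
      (IsLocalRing.maximalIdeal O).map (C : O →+* MvPolynomial (Fin n) O) ≤ P.asIdeal := by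
  rw [Ideal.map_le_iff_le_comap, ← fS_base_asIdeal]
  constructor
  · intro h
    rw [h]
    exact le_rfl
  · intro h
    apply PrimeSpectrum.ext
    exact ((IsLocalRing.maximalIdeal.isMaximal O).eq_of_le (Ideal.IsPrime.ne_top inferInstance) h).symm

/-- **The special fibre of `𝔸ⁿ_O → Spec O` is the image of `𝔸ⁿ_k`** (`k = O/𝔪` via the surjection `π`): a point lies over the
closed point iff it is in the range of `Spec (map π) : 𝔸ⁿ_k → 𝔸ⁿ_O`. -/
theorem fS_apply_eq_closedPoint_iff_mem_range (P : PS n O) :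
    (fS n O).base P = IsLocalRing.closedPoint O ↔
      P ∈ Set.range (Spec.map (CommRingCat.ofHom (MvPolynomial.map (σ := Fin n) π))).base := by
  rw [fS_apply_eq_closedPoint_iff, mem_range_specMap_map_iff π hπ, MvPolynomial.ker_map,
    ker_eq_maximalIdeal_of_surjective π hπ]

/-- **The special fibre of the centre `Z_J,O = V(u_j : j ∈ J) ⊆ 𝔸ⁿ_O` is the image of the k-centre `Z_J,k`**:
a point of `V(I_J,O)` over the closed point is the image under `Spec (map π)` of a point of `V(I_J,k)`, and conversely. -/
theorem le_asIdeal_and_eq_closedPoint_iff (J : Set (Fin n)) (P : PS n O) :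
    (IΛS n O J ≤ P.asIdeal ∧ (fS n O).base P = IsLocalRing.closedPoint O) ↔
      ∃ Q : PS n k, IΛS n k J ≤ Q.asIdeal ∧
        (Spec.map (CommRingCat.ofHom (MvPolynomial.map (σ := Fin n) π))).base Q = P := by
  rw [fS_apply_eq_closedPoint_iff_mem_range π hπ]
  constructor
  · rintro ⟨hP, ⟨Q, rfl⟩⟩
    exact ⟨Q, (IΛS_le_comap_iff π J Q).mp hP, rfl⟩
  · rintro ⟨Q, hQ', rfl⟩
    exact ⟨(IΛS_le_comap_iff π J Q).mpr hQ', ⟨Q, rfl⟩⟩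

end SpecialFibre

end Summit.ResolutionOfSingularities.ResolutionOfSingularities.Cruxes.EquisingularLiftNatThree.Ideas.ToricTowers

end
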